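import Literature.Computability.Complexity.HardcoreInapproximabilityProofs
import Literature.Computability.Complexity.HardcoreInapproximabilitySums
import HarnessLib

/-!
# Sly's phase gadget `G(n, θ, ψ)` as an explicit graph: construction, structure, and the cut at `U`

Sly 2010 (*Computational transition at the uniqueness threshold*, FOCS 2010), §2.1 and §4.1. The
named fact `Literature.Computability.Complexity.slyGadgetReduction` (Theorem 2.1 with Lemma 2.2,
derandomised) asks, for every large `n`, for a graph `G` on `Fin v`, `v ≤ 3n`, of maximum degree `d`,
with disjoint vertex sets `W⁺, W⁻` and `m = slyM d θ n` ports `V⁺, V⁻ : Fin m ↪ Fin v` of degree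
`≤ d - 1`, satisfying the phase properties (GpropA), (GpropB). Sly's `G = G(n, θ, ψ)` is RANDOM: the
two halves `W^{±} ∪ U^{±} = [n] ⊔ [m']` are joined by `d - 1` uniform perfect matchings `σ_i` and
`W⁺`, `W⁻` by one more, `τ` (this is the core `G̃`), and onto the `m' = m (d-1)^D` vertices `U^{±}`
of each half are hung `m` complete `(d-1)`-ary trees of depth `D = 2⌊(ψ/2) log_{d-1} n⌋` whose
roots are the ports `V^{±}`. This file makes the DETERMINISTIC part of that construction explicit,
for an arbitrary realisation `(σ, τ)` of the matchings, and proves everything about `G` that does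
not depend on the randomness:

* the vertex type `SlyV n m D q` (`q = d - 1`; halves `SlySideV = Fin n ⊕ SlyTreeV`, forest
  vertices `SlyTreeV m D q = {(l, j, p) : p < q^l, l ≤ D}`), the edge relation `SlyRel σ τ`, the graph
  `slyGadgetGraph n m D q σ τ` and its copy `slyGadgetFin` on `Fin v` (`v = #SlyV`, numbering
  `slyNum`), the sets `W^{±}` (`slyWPlus/WMinus`, on `SlyV`: `slyWp/Wm`) and the port embeddings
  `V^{±}` (`slyPortPlus/Minus`, on `SlyV`: `slyRp/Rm`, the roots `slyRoot`);
* STRUCTURE [Sly2010, §2.1]: every vertex has degree `≤ q + 1 = d` (`slyGadget_degree_le`,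
  `slyGadget_maxDegree_le`, `slyGadgetFin_maxDegree_le`), the ports have degree `≤ q = d - 1`
  (`slyGadget_degree_plusRoot/minusRoot`, `slyGadgetFin_degree_portPlus/Minus`), `W⁺ ∩ W⁻ = ∅`,
  `V⁺ ∩ V⁻ = ∅` (`disjoint_slyW`, `disjoint_slyPort`), `#SlyV ≤ 2n + 2(D+1) m q^D` (`card_slyV_le`), and
  with Sly's parameters `m = slyM Δ θ n ≤ n^θ`, `(Δ-1)^D ≤ n^ψ` for `D = slyDepth Δ ψ n`
  (`slyM_le_rpow`, `pow_slyDepth_le_rpow`) the bound `2n + 2(D+1) m q^D ≤ 3n` for all large `n` when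
  `θ + ψ < 1` (`sly_vertexBound_eventually`);
* THE CUT AT `U` [Sly2010, §4.1]: the realised core weights `slyCoreZ σ τ λ s (E⁺, E⁻)` (Sly's
  `Z^{±}_{G̃}(η)` before expectations; the independence event `SlyCoreIndep` is literally the one
  averaged in `sly_firstMoment`) and the forest weights `slyForestZ m D q λ E S` (Sly's `κ(η)`, refined
  by the occupied roots `S`), and the exact decomposition
  `Z_G(λ; Y = s ∧ σ_V = (S⁺,S⁻)) = Σ_{(E⁺,E⁻)} Z^{s}_{G̃(σ,τ)}(E⁺,E⁻) κ_{S⁺}(E⁺) κ_{S⁻}(E⁻)`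
  (`hardcoreZOn_slyGadget_phase_pattern`, over `Fin v`: `hardcoreZOn_slyGadgetFin_phase_pattern`,
  and summed over the ports `hardcoreZOn_slyGadgetFin_phase` — Sly's
  "`E Z^{±}_G = Σ_η E Z^{±}_{G̃}(η) κ(η)`" before taking expectations), via the invariance of restricted
  partition functions under relabelling (`hardcoreZOn_map_equiv`) and fibrewise additivity
  (`hardcoreZOn_eq_sum_fiber`);
* THE FIRST MOMENT OF THE CORE WEIGHTS [Sly2010, §3, eq. (e:gtEZ1)]: averaged over
  `(σ, τ) ∈ (Perm [n+m'])^k × Perm [n]`, `slyCoreZ … true (E⁺,E⁻)` is `slyZplus n m' k λ |E⁺| |E⁻|` and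
  `slyCoreZ … false (E⁺,E⁻)` is `slyZminus …` (`slyCoreZ_average_true/false`, from `sly_firstMoment`),
  which is where Lemma 3.3 (`sly_lemma33`, file `HardcoreInapproximabilityFirstMoment`) attaches.

What is NOT here (the probabilistic content of Theorem 2.1): the second-moment bounds and small
subgraph conditioning for `Z^{±}_{G̃}(η)` (§3.1–3.2) and the reconstruction estimates on the trees
(§4), which turn the identities above into (GpropA), (GpropB) for most realisations `(σ, τ)`.
No `Prop`-valued definitions.

## References

* A. Sly, *Computational transition at the uniqueness threshold*, FOCS 2010, arXiv:1005.5584: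
  §2.1 (construction of `G̃` and `G`, the numbers `m`, `m'`, the depth `2⌊(ψ/2) log_{d-1} n⌋`, maximum
  degree `d`), §3 (eq. (e:gtEZ1), `Z^{±}_{G̃}(η)`), §4.1 (`κ(η)`, the measure on `σ_V`, and
  "`E Z^{±}_G = Σ_η E Z^{±}_{G̃}(η) κ(η)`" in the proof of Theorem 2.1) [Sly2010].
-/

namespace Literature.Computability.Complexity

open Finset

section GadgetConstruction

/-- Vertices of the forest of `m` complete `q`-ary trees of depth `D` appended to one half of Sly's
gadget: `(l, j, p)` = the `p`-th vertex (`p < q^l`) on level `l ≤ D` of the `j`-th tree; level `0`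
are the roots (the ports `V`), level `D` the leaves (identified with `U`).
[cite: Sly2010, §2.1 (construction of `G`: "a collection of `m` disconnected `(d-1)`-ary trees of depth `2⌊(ψ/2) log_{d-1} n⌋`")] -/
abbrev SlyTreeV (m D q : ℕ) : Type :=
  {t : Fin (D + 1) × Fin m × ℕ // t.2.2 < q ^ (t.1 : ℕ)}

/-- One half of Sly's gadget: `W = Fin n` and the appended forest. [cite: Sly2010, §2.1] -/
abbrev SlySideV (n m D q : ℕ) : Type := Fin n ⊕ SlyTreeV m D q

/-- The vertex type of Sly's gadget `G(n, θ, ψ)`: the plus half and the minus half. [cite: Sly2010, §2.1] -/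
abbrev SlyV (n m D q : ℕ) : Type := SlySideV n m D q ⊕ SlySideV n m D q

variable {n m D q : ℕ}

/-- Equality of forest vertices is decidable (by their coordinates). [folklore] -/
instance instDecidableEqSlyTreeV (m D q : ℕ) : DecidableEq (SlyTreeV m D q) :=
  fun a b => decidable_of_iff (a.1 = b.1) Subtype.ext_iff.symm

/-- Equality of gadget vertices is decidable. [folklore] -/
instance instDecidableEqSlyV (n m D q : ℕ) : DecidableEq (SlyV n m D q) := by
  unfold SlyV SlySideV; infer_instance

/-- The forest vertices are the dependent triples `(l, j, p)`, `p < q^l`. [folklore] -/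
def slyTreeEquiv (m D q : ℕ) : SlyTreeV m D q ≃ Σ l : Fin (D + 1), Fin m × Fin (q ^ (l : ℕ)) where
  toFun t := ⟨t.1.1, (t.1.2.1, ⟨t.1.2.2, t.2⟩)⟩
  invFun s := ⟨(s.1, s.2.1, (s.2.2 : ℕ)), s.2.2.isLt⟩
  left_inv _ := rfl
  right_inv _ := rfl

/-- The forest is finite. [folklore] -/
instance instFintypeSlyTreeV (m D q : ℕ) : Fintype (SlyTreeV m D q) :=
  Fintype.ofEquiv _ (slyTreeEquiv m D q).symm

/-- The forest has `Σ_{l ≤ D} m q^l` vertices. [folklore] -/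
theorem card_slyTreeV (m D q : ℕ) :
    Fintype.card (SlyTreeV m D q) = ∑ l : Fin (D + 1), m * q ^ (l : ℕ) := by
  rw [Fintype.card_congr (slyTreeEquiv m D q), Fintype.card_sigma]
  simp [Fintype.card_prod, Fintype.card_fin]

/-- The leaf of the forest numbered by `u < m q^D` (tree `j`, position `p`, via `finProdFinEquiv`). [folklore] -/
def slyLeaf (m D q : ℕ) (u : Fin (m * q ^ D)) : SlyTreeV m D q :=
  ⟨(Fin.last D, (finProdFinEquiv.symm u).1, ((finProdFinEquiv.symm u).2 : ℕ)),
    by simpa using ((finProdFinEquiv.symm u).2).isLt⟩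

/-- Distinct indices give distinct leaves. [folklore] -/
theorem slyLeaf_injective (m D q : ℕ) : Function.Injective (slyLeaf m D q) := by
  intro u u' h
  simp only [slyLeaf, Subtype.mk.injEq, Prod.mk.injEq, true_and] at h
  obtain ⟨h1, h2⟩ := h
  apply finProdFinEquiv.symm.injective
  exact Prod.ext h1 (Fin.ext h2)

/-- The vertices of one half met by the big matchings, numbered by `Fin (n + m q^D)`: first `W = Fin n`,
then the leaves `U`. [cite: Sly2010, §2.1 ("`d-1` random perfect matchings of `W⁺ ∪ U⁺` with `W⁻ ∪ U⁻`")] -/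
def slyMatchVertex (n m D q : ℕ) (i : Fin (n + m * q ^ D)) : SlySideV n m D q :=
  Sum.elim (fun w => Sum.inl w) (fun u => Sum.inr (slyLeaf m D q u)) (finSumFinEquiv.symm i)

/-- The numbering of the matched vertices is injective. [folklore] -/
theorem slyMatchVertex_injective (n m D q : ℕ) : Function.Injective (slyMatchVertex n m D q) := by
  intro i i' h
  apply finSumFinEquiv.symm.injective
  unfold slyMatchVertex at h
  rcases hx : finSumFinEquiv.symm i with w | u <;> rcases hx' : finSumFinEquiv.symm i' with w' | u' <;>
    simp only [hx, hx', Sum.elim_inl, Sum.elim_inr, Sum.inl.injEq, Sum.inr.injEq, reduceCtorEq] at h ⊢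
  · exact h
  · exact slyLeaf_injective m D q h

/-- `t'` is a child of `t` in the forest: one level down, same tree, `⌊p'/q⌋ = p`. [folklore] -/
def SlyIsChild (q : ℕ) (t t' : SlyTreeV m D q) : Prop :=
  (t'.1.1 : ℕ) = t.1.1 + 1 ∧ t'.1.2.1 = t.1.2.1 ∧ t'.1.2.2 / q = t.1.2.2

/-- The edge relation of Sly's gadget before symmetrisation: the `q = d-1` big matchings `σ_k` (plus
matched vertex `i` to minus matched vertex `σ_k i`), the small matching `τ` of `W⁺` with `W⁻`, and the
parent–child edges of the two forests. [cite: Sly2010, §2.1 (construction of `G̃` and of `G`)] -/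
def SlyRel (n m D q : ℕ) (σ : Fin q → Equiv.Perm (Fin (n + m * q ^ D))) (τ : Equiv.Perm (Fin n)) :
    SlyV n m D q → SlyV n m D q → Prop := fun x y =>
  (∃ (k : Fin q) (i : Fin (n + m * q ^ D)),
      x = Sum.inl (slyMatchVertex n m D q i) ∧ y = Sum.inr (slyMatchVertex n m D q (σ k i))) ∨
  (∃ w : Fin n, x = Sum.inl (Sum.inl w) ∧ y = Sum.inr (Sum.inl (τ w))) ∨
  (∃ t t' : SlyTreeV m D q, SlyIsChild q t t' ∧
      ((x = Sum.inl (Sum.inr t) ∧ y = Sum.inl (Sum.inr t')) ∨ (x = Sum.inr (Sum.inr t) ∧ y = Sum.inr (Sum.inr t'))))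

/-- **Sly's gadget `G(n, θ, ψ)` as a simple graph** on `SlyV n m D q`, for given matchings: the
symmetric irreflexive closure of `SlyRel` (multiple edges collapse, as Sly notes they may be).
[cite: Sly2010, §2.1 (construction of `G`)] -/
def slyGadgetGraph (n m D q : ℕ) (σ : Fin q → Equiv.Perm (Fin (n + m * q ^ D))) (τ : Equiv.Perm (Fin n)) :
    SimpleGraph (SlyV n m D q) :=
  SimpleGraph.fromRel (SlyRel n m D q σ τ)

/-! #### Unpacking the matched vertices and the forest structure -/

/-- The first `n` matched vertices are `W`. [folklore] -/
theorem slyMatchVertex_inl (w : Fin n) :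
    slyMatchVertex n m D q (finSumFinEquiv (Sum.inl w)) = Sum.inl w := by
  simp [slyMatchVertex]

/-- The last `m q^D` matched vertices are the leaves `U`. [folklore] -/
theorem slyMatchVertex_inr (u : Fin (m * q ^ D)) :
    slyMatchVertex n m D q (finSumFinEquiv (Sum.inr u)) = Sum.inr (slyLeaf m D q u) := by
  simp [slyMatchVertex]

/-- A matched vertex is `w ∈ W` iff its number is `castAdd w`. [folklore] -/
theorem slyMatchVertex_eq_inl_iff (i : Fin (n + m * q ^ D)) (w : Fin n) :
    slyMatchVertex n m D q i = Sum.inl w ↔ i = finSumFinEquiv (Sum.inl w) := by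
  constructor
  · intro h
    apply slyMatchVertex_injective n m D q
    rw [h, slyMatchVertex_inl]
  · rintro rfl; exact slyMatchVertex_inl w

/-- A matched vertex is a forest vertex iff it is a leaf, numbered `natAdd u`. [folklore] -/
theorem slyMatchVertex_eq_inr_iff (i : Fin (n + m * q ^ D)) (t : SlyTreeV m D q) :
    slyMatchVertex n m D q i = Sum.inr t ↔ ∃ u, t = slyLeaf m D q u ∧ i = finSumFinEquiv (Sum.inr u) := by
  constructor
  · intro h
    unfold slyMatchVertex at h
    rcases hx : finSumFinEquiv.symm i with w | u
    · rw [hx] at h; simp at h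
    · rw [hx] at h
      simp only [Sum.elim_inr, Sum.inr.injEq] at h
      refine ⟨u, h.symm, ?_⟩
      rw [← hx, Equiv.apply_symm_apply]
  · rintro ⟨u, rfl, rfl⟩; exact slyMatchVertex_inr u

/-- Leaves sit on level `D`. [folklore] -/
theorem slyLeaf_level (u : Fin (m * q ^ D)) : ((slyLeaf m D q u).1.1 : ℕ) = D := by
  simp [slyLeaf]

/-- Every vertex of level `D` is a leaf `slyLeaf u`. [folklore] -/
theorem exists_slyLeaf_of_level {t : SlyTreeV m D q} (h : (t.1.1 : ℕ) = D) :
    ∃ u, slyLeaf m D q u = t := by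
  obtain ⟨⟨l, j, p⟩, hp⟩ := t
  simp only at h hp
  have hpD : p < q ^ D := by rw [← h]; exact hp
  refine ⟨finProdFinEquiv (j, ⟨p, hpD⟩), ?_⟩
  simp only [slyLeaf, Equiv.symm_apply_apply]
  apply Subtype.ext
  simp only
  ext
  · simp only [Fin.val_last]; exact h.symm
  · rfl
  · rfl

/-- Leaves have no children. [folklore] -/
theorem not_isChild_of_level {t : SlyTreeV m D q} (h : (t.1.1 : ℕ) = D) (t' : SlyTreeV m D q) :
    ¬SlyIsChild q t t' := by
  rintro ⟨h1, -, -⟩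
  have := t'.1.1.isLt
  omega

/-- Roots have no parent. [folklore] -/
theorem not_isChild_root {t : SlyTreeV m D q} (h : (t.1.1 : ℕ) = 0) (t₀ : SlyTreeV m D q) :
    ¬SlyIsChild q t₀ t := by
  rintro ⟨h1, -, -⟩
  omega

/-- A forest vertex has at most `q` children. [folklore] -/
theorem card_children_le (hq : 0 < q) (t : SlyTreeV m D q) [DecidablePred (SlyIsChild q t)] :
    (univ.filter (SlyIsChild q t)).card ≤ q := by
  have key : Set.InjOn (fun t' : SlyTreeV m D q => (⟨t'.1.2.2 % q, Nat.mod_lt _ hq⟩ : Fin q))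
      ↑(univ.filter (SlyIsChild q t)) := by
    intro a ha b hb hab
    simp only [coe_filter, mem_univ, true_and, Set.mem_setOf_eq] at ha hb
    obtain ⟨ha1, ha2, ha3⟩ := ha
    obtain ⟨hb1, hb2, hb3⟩ := hb
    simp only [Fin.mk.injEq] at hab
    have hp : a.1.2.2 = b.1.2.2 := by
      rw [← Nat.div_add_mod a.1.2.2 q, ← Nat.div_add_mod b.1.2.2 q, ha3, hb3, hab]
    apply Subtype.ext
    ext
    · exact Fin.ext (by omega) |> congrArg Fin.val
    · rw [ha2, hb2]
    · exact hp
  calc (univ.filter (SlyIsChild q t)).card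
      ≤ (univ : Finset (Fin q)).card := card_le_card_of_injOn _ (fun _ _ => mem_univ _) key
    _ = q := by simp

/-- A forest vertex has at most one parent. [folklore] -/
theorem card_parent_le (t : SlyTreeV m D q) [DecidablePred (fun t₀ => SlyIsChild q t₀ t)] :
    (univ.filter (fun t₀ => SlyIsChild q t₀ t)).card ≤ 1 := by
  refine card_le_one.2 fun a ha b hb => ?_
  simp only [mem_filter, mem_univ, true_and] at ha hb
  obtain ⟨ha1, ha2, ha3⟩ := ha
  obtain ⟨hb1, hb2, hb3⟩ := hb
  apply Subtype.ext
  ext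
  · exact Fin.ext (by omega) |> congrArg Fin.val
  · rw [← ha2, ← hb2]
  · rw [← ha3, ← hb3]

/-! #### The neighbours of each kind of vertex -/

section Adj
variable (σ : Fin q → Equiv.Perm (Fin (n + m * q ^ D))) (τ : Equiv.Perm (Fin n))

/-- Adjacency in the gadget, unfolded. [folklore] -/
theorem slyGadget_adj_iff (x y : SlyV n m D q) :
    (slyGadgetGraph n m D q σ τ).Adj x y ↔ x ≠ y ∧ (SlyRel n m D q σ τ x y ∨ SlyRel n m D q σ τ y x) :=
  Iff.rfl

/-- Neighbours of a vertex of `W⁺`: its `q` big-matching partners and its small-matching partner. [folklore] -/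
theorem slyGadget_adj_plusW {w : Fin n} {y : SlyV n m D q}
    (h : (slyGadgetGraph n m D q σ τ).Adj (Sum.inl (Sum.inl w)) y) :
    (∃ k : Fin q, y = Sum.inr (slyMatchVertex n m D q (σ k (finSumFinEquiv (Sum.inl w))))) ∨
      y = Sum.inr (Sum.inl (τ w)) := by
  obtain ⟨-, h | h⟩ := h
  · rcases h with ⟨k, i, hx, hy⟩ | ⟨w', hx, hy⟩ | ⟨t, t', -, ⟨hx, -⟩ | ⟨hx, -⟩⟩
    · rw [Sum.inl.injEq, eq_comm, slyMatchVertex_eq_inl_iff] at hx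
      subst hx; exact Or.inl ⟨k, hy⟩
    · simp only [Sum.inl.injEq] at hx
      subst hx; exact Or.inr hy
    · simp at hx
    · simp at hx
  · rcases h with ⟨k, i, -, hx⟩ | ⟨w', -, hx⟩ | ⟨t, t', -, ⟨-, hx⟩ | ⟨-, hx⟩⟩ <;> simp at hx

/-- Neighbours of a vertex of `W⁻`: the `q` big-matching preimages and the small-matching preimage. [folklore] -/
theorem slyGadget_adj_minusW {w : Fin n} {y : SlyV n m D q}
    (h : (slyGadgetGraph n m D q σ τ).Adj (Sum.inr (Sum.inl w)) y) :
    (∃ k : Fin q, y = Sum.inl (slyMatchVertex n m D q ((σ k).symm (finSumFinEquiv (Sum.inl w))))) ∨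
      y = Sum.inl (Sum.inl (τ.symm w)) := by
  obtain ⟨-, h | h⟩ := h
  · rcases h with ⟨k, i, hx, -⟩ | ⟨w', hx, -⟩ | ⟨t, t', -, ⟨hx, -⟩ | ⟨hx, -⟩⟩ <;> simp at hx
  · rcases h with ⟨k, i, hy, hx⟩ | ⟨w', hy, hx⟩ | ⟨t, t', -, ⟨-, hx⟩ | ⟨-, hx⟩⟩
    · rw [Sum.inr.injEq, eq_comm, slyMatchVertex_eq_inl_iff] at hx
      refine Or.inl ⟨k, ?_⟩
      rw [hy, ← hx, Equiv.symm_apply_apply]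
    · simp only [Sum.inr.injEq, Sum.inl.injEq] at hx
      refine Or.inr ?_
      rw [hy, hx, Equiv.symm_apply_apply]
    · simp at hx
    · simp at hx

/-- Neighbours of a forest vertex `t` of the plus half: big-matching partners (if `t` is a leaf,
`t = slyLeaf u`), children and parent. [folklore] -/
theorem slyGadget_adj_plusT {t : SlyTreeV m D q} {y : SlyV n m D q}
    (h : (slyGadgetGraph n m D q σ τ).Adj (Sum.inl (Sum.inr t)) y) :
    (∃ (k : Fin q) (u : Fin (m * q ^ D)), t = slyLeaf m D q u ∧
        y = Sum.inr (slyMatchVertex n m D q (σ k (finSumFinEquiv (Sum.inr u))))) ∨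
      (∃ t', SlyIsChild q t t' ∧ y = Sum.inl (Sum.inr t')) ∨
      (∃ t₀, SlyIsChild q t₀ t ∧ y = Sum.inl (Sum.inr t₀)) := by
  obtain ⟨-, h | h⟩ := h
  · rcases h with ⟨k, i, hx, hy⟩ | ⟨w', hx, -⟩ | ⟨t₁, t', hc, ⟨hx, hy⟩ | ⟨hx, -⟩⟩
    · rw [Sum.inl.injEq, eq_comm, slyMatchVertex_eq_inr_iff] at hx
      obtain ⟨u, rfl, rfl⟩ := hx
      exact Or.inl ⟨k, u, rfl, hy⟩
    · simp at hx
    · simp only [Sum.inl.injEq, Sum.inr.injEq] at hx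
      subst hx; exact Or.inr (Or.inl ⟨t', hc, hy⟩)
    · simp at hx
  · rcases h with ⟨k, i, -, hx⟩ | ⟨w', -, hx⟩ | ⟨t₀, t₁, hc, ⟨hy, hx⟩ | ⟨-, hx⟩⟩
    · simp at hx
    · simp at hx
    · simp only [Sum.inl.injEq, Sum.inr.injEq] at hx
      subst hx; exact Or.inr (Or.inr ⟨t₀, hc, hy⟩)
    · simp at hx

/-- Neighbours of a forest vertex `t` of the minus half. [folklore] -/
theorem slyGadget_adj_minusT {t : SlyTreeV m D q} {y : SlyV n m D q}
    (h : (slyGadgetGraph n m D q σ τ).Adj (Sum.inr (Sum.inr t)) y) :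
    (∃ (k : Fin q) (u : Fin (m * q ^ D)), t = slyLeaf m D q u ∧
        y = Sum.inl (slyMatchVertex n m D q ((σ k).symm (finSumFinEquiv (Sum.inr u))))) ∨
      (∃ t', SlyIsChild q t t' ∧ y = Sum.inr (Sum.inr t')) ∨
      (∃ t₀, SlyIsChild q t₀ t ∧ y = Sum.inr (Sum.inr t₀)) := by
  obtain ⟨-, h | h⟩ := h
  · rcases h with ⟨k, i, hx, -⟩ | ⟨w', hx, -⟩ | ⟨t₁, t', hc, ⟨hx, -⟩ | ⟨hx, hy⟩⟩
    · simp at hx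
    · simp at hx
    · simp at hx
    · simp only [Sum.inr.injEq] at hx
      subst hx; exact Or.inr (Or.inl ⟨t', hc, hy⟩)
  · rcases h with ⟨k, i, hy, hx⟩ | ⟨w', -, hx⟩ | ⟨t₀, t₁, hc, ⟨-, hx⟩ | ⟨hy, hx⟩⟩
    · rw [Sum.inr.injEq, eq_comm, slyMatchVertex_eq_inr_iff] at hx
      obtain ⟨u, rfl, hi⟩ := hx
      refine Or.inl ⟨k, u, rfl, ?_⟩
      rw [hy, ← hi, Equiv.symm_apply_apply]
    · simp at hx
    · simp at hx
    · simp only [Sum.inr.injEq] at hx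
      subst hx; exact Or.inr (Or.inr ⟨t₀, hc, hy⟩)

end Adj

/-! #### Degree bounds -/

/-- A vertex all of whose neighbours lie in `S` has degree `≤ #S`. [folklore] -/
theorem degree_le_card_of_forall_adj {V : Type*} (G : SimpleGraph V) (v : V) [Fintype (G.neighborSet v)]
    (S : Finset V) (h : ∀ w, G.Adj v w → w ∈ S) : G.degree v ≤ S.card := by
  rw [← SimpleGraph.card_neighborFinset_eq_degree]
  exact card_le_card fun w hw => h w ((SimpleGraph.mem_neighborFinset _ _ _).1 hw)

/-- The root of the `j`-th tree (a port). [folklore] -/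
def slyRoot (m D q : ℕ) (j : Fin m) : SlyTreeV m D q := ⟨(0, j, 0), by simp⟩

/-- Distinct trees have distinct roots. [folklore] -/
theorem slyRoot_injective (m D q : ℕ) : Function.Injective (slyRoot m D q) := by
  intro j j' h
  simpa [slyRoot] using h

section Degrees
variable (σ : Fin q → Equiv.Perm (Fin (n + m * q ^ D))) (τ : Equiv.Perm (Fin n))
variable [DecidableRel (slyGadgetGraph n m D q σ τ).Adj]

/-- Vertices of `W⁺` have degree `≤ q + 1 = d`. [folklore] -/
theorem slyGadget_degree_plusW (w : Fin n) :
    (slyGadgetGraph n m D q σ τ).degree (Sum.inl (Sum.inl w)) ≤ q + 1 := by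
  classical
  set S : Finset (SlyV n m D q) :=
    (univ.image fun k : Fin q =>
        (Sum.inr (slyMatchVertex n m D q (σ k (finSumFinEquiv (Sum.inl w)))) : SlyV n m D q)) ∪
      {Sum.inr (Sum.inl (τ w))} with hS
  refine (degree_le_card_of_forall_adj _ _ S ?_).trans ?_
  · intro y hy
    rcases slyGadget_adj_plusW σ τ hy with ⟨k, rfl⟩ | rfl
    · exact mem_union_left _ (mem_image.2 ⟨k, mem_univ _, rfl⟩)
    · exact mem_union_right _ (mem_singleton_self _)
  · calc S.card ≤ (univ.image fun k : Fin q =>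
          (Sum.inr (slyMatchVertex n m D q (σ k (finSumFinEquiv (Sum.inl w)))) : SlyV n m D q)).card +
          ({(Sum.inr (Sum.inl (τ w)) : SlyV n m D q)} : Finset _).card := card_union_le _ _
      _ ≤ q + 1 := by
        rw [card_singleton]
        exact Nat.add_le_add_right (card_image_le.trans (by simp)) 1

/-- Vertices of `W⁻` have degree `≤ q + 1 = d`. [folklore] -/
theorem slyGadget_degree_minusW (w : Fin n) :
    (slyGadgetGraph n m D q σ τ).degree (Sum.inr (Sum.inl w)) ≤ q + 1 := by
  classical
  set S : Finset (SlyV n m D q) :=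
    (univ.image fun k : Fin q =>
        (Sum.inl (slyMatchVertex n m D q ((σ k).symm (finSumFinEquiv (Sum.inl w)))) : SlyV n m D q)) ∪
      {Sum.inl (Sum.inl (τ.symm w))} with hS
  refine (degree_le_card_of_forall_adj _ _ S ?_).trans ?_
  · intro y hy
    rcases slyGadget_adj_minusW σ τ hy with ⟨k, rfl⟩ | rfl
    · exact mem_union_left _ (mem_image.2 ⟨k, mem_univ _, rfl⟩)
    · exact mem_union_right _ (mem_singleton_self _)
  · calc S.card ≤ (univ.image fun k : Fin q =>
          (Sum.inl (slyMatchVertex n m D q ((σ k).symm (finSumFinEquiv (Sum.inl w)))) : SlyV n m D q)).card +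
          ({(Sum.inl (Sum.inl (τ.symm w)) : SlyV n m D q)} : Finset _).card := card_union_le _ _
      _ ≤ q + 1 := by
        rw [card_singleton]
        exact Nat.add_le_add_right (card_image_le.trans (by simp)) 1

open scoped Classical in
/-- Forest vertices of the plus half have degree `≤ q + #(parents)` (`q` matching partners or `q`
children, plus the parent if any). [folklore] -/
theorem slyGadget_degree_plusT_le (hq : 0 < q) (t : SlyTreeV m D q) :
    (slyGadgetGraph n m D q σ τ).degree (Sum.inl (Sum.inr t)) ≤
      q + (univ.filter fun t₀ => SlyIsChild q t₀ t).card := by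
  classical
  set P : Finset (SlyV n m D q) :=
    (univ.filter fun t₀ => SlyIsChild q t₀ t).image fun t₀ => (Sum.inl (Sum.inr t₀) : SlyV n m D q) with hP
  have hPc : P.card ≤ (univ.filter fun t₀ => SlyIsChild q t₀ t).card := card_image_le
  by_cases hl : (t.1.1 : ℕ) = D
  · -- a leaf: matching partners and the parent
    obtain ⟨u, rfl⟩ := exists_slyLeaf_of_level hl
    set S : Finset (SlyV n m D q) :=
      (univ.image fun k : Fin q =>
        (Sum.inr (slyMatchVertex n m D q (σ k (finSumFinEquiv (Sum.inr u)))) : SlyV n m D q)) ∪ P with hS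
    refine (degree_le_card_of_forall_adj _ _ S ?_).trans ?_
    · intro y hy
      rcases slyGadget_adj_plusT σ τ hy with ⟨k, u', hu', rfl⟩ | ⟨t', hc, rfl⟩ | ⟨t₀, hc, rfl⟩
      · rw [(slyLeaf_injective m D q hu').symm]
        exact mem_union_left _ (mem_image.2 ⟨k, mem_univ _, rfl⟩)
      · exact absurd hc (not_isChild_of_level hl t')
      · exact mem_union_right _ (mem_image.2 ⟨t₀, mem_filter.2 ⟨mem_univ _, hc⟩, rfl⟩)
    · calc S.card ≤ (univ.image fun k : Fin q =>
            (Sum.inr (slyMatchVertex n m D q (σ k (finSumFinEquiv (Sum.inr u)))) : SlyV n m D q)).card +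
            P.card := card_union_le _ _
        _ ≤ q + _ := add_le_add (card_image_le.trans (by simp)) hPc
  · -- an internal vertex: children and the parent
    set S : Finset (SlyV n m D q) :=
      ((univ.filter (SlyIsChild q t)).image fun t' => (Sum.inl (Sum.inr t') : SlyV n m D q)) ∪ P with hS
    refine (degree_le_card_of_forall_adj _ _ S ?_).trans ?_
    · intro y hy
      rcases slyGadget_adj_plusT σ τ hy with ⟨k, u', hu', rfl⟩ | ⟨t', hc, rfl⟩ | ⟨t₀, hc, rfl⟩
      · exact absurd (hu' ▸ slyLeaf_level u') hl
      · exact mem_union_left _ (mem_image.2 ⟨t', mem_filter.2 ⟨mem_univ _, hc⟩, rfl⟩)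
      · exact mem_union_right _ (mem_image.2 ⟨t₀, mem_filter.2 ⟨mem_univ _, hc⟩, rfl⟩)
    · calc S.card ≤ ((univ.filter (SlyIsChild q t)).image fun t' =>
            (Sum.inl (Sum.inr t') : SlyV n m D q)).card + P.card := card_union_le _ _
        _ ≤ q + _ := add_le_add (card_image_le.trans (card_children_le hq t)) hPc

open scoped Classical in
/-- Forest vertices of the minus half have degree `≤ q + #(parents)`. [folklore] -/
theorem slyGadget_degree_minusT_le (hq : 0 < q) (t : SlyTreeV m D q) :
    (slyGadgetGraph n m D q σ τ).degree (Sum.inr (Sum.inr t)) ≤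
      q + (univ.filter fun t₀ => SlyIsChild q t₀ t).card := by
  classical
  set P : Finset (SlyV n m D q) :=
    (univ.filter fun t₀ => SlyIsChild q t₀ t).image fun t₀ => (Sum.inr (Sum.inr t₀) : SlyV n m D q) with hP
  have hPc : P.card ≤ (univ.filter fun t₀ => SlyIsChild q t₀ t).card := card_image_le
  by_cases hl : (t.1.1 : ℕ) = D
  · obtain ⟨u, rfl⟩ := exists_slyLeaf_of_level hl
    set S : Finset (SlyV n m D q) :=
      (univ.image fun k : Fin q =>
        (Sum.inl (slyMatchVertex n m D q ((σ k).symm (finSumFinEquiv (Sum.inr u)))) : SlyV n m D q)) ∪ P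
      with hS
    refine (degree_le_card_of_forall_adj _ _ S ?_).trans ?_
    · intro y hy
      rcases slyGadget_adj_minusT σ τ hy with ⟨k, u', hu', rfl⟩ | ⟨t', hc, rfl⟩ | ⟨t₀, hc, rfl⟩
      · rw [(slyLeaf_injective m D q hu').symm]
        exact mem_union_left _ (mem_image.2 ⟨k, mem_univ _, rfl⟩)
      · exact absurd hc (not_isChild_of_level hl t')
      · exact mem_union_right _ (mem_image.2 ⟨t₀, mem_filter.2 ⟨mem_univ _, hc⟩, rfl⟩)
    · calc S.card ≤ (univ.image fun k : Fin q =>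
            (Sum.inl (slyMatchVertex n m D q ((σ k).symm (finSumFinEquiv (Sum.inr u)))) : SlyV n m D q)).card +
            P.card := card_union_le _ _
        _ ≤ q + _ := add_le_add (card_image_le.trans (by simp)) hPc
  · set S : Finset (SlyV n m D q) :=
      ((univ.filter (SlyIsChild q t)).image fun t' => (Sum.inr (Sum.inr t') : SlyV n m D q)) ∪ P with hS
    refine (degree_le_card_of_forall_adj _ _ S ?_).trans ?_
    · intro y hy
      rcases slyGadget_adj_minusT σ τ hy with ⟨k, u', hu', rfl⟩ | ⟨t', hc, rfl⟩ | ⟨t₀, hc, rfl⟩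
      · exact absurd (hu' ▸ slyLeaf_level u') hl
      · exact mem_union_left _ (mem_image.2 ⟨t', mem_filter.2 ⟨mem_univ _, hc⟩, rfl⟩)
      · exact mem_union_right _ (mem_image.2 ⟨t₀, mem_filter.2 ⟨mem_univ _, hc⟩, rfl⟩)
    · calc S.card ≤ ((univ.filter (SlyIsChild q t)).image fun t' =>
            (Sum.inr (Sum.inr t') : SlyV n m D q)).card + P.card := card_union_le _ _
        _ ≤ q + _ := add_le_add (card_image_le.trans (card_children_le hq t)) hPc

/-- **Every vertex of Sly's gadget has degree `≤ q + 1 = d`.** [cite: Sly2010, §2.1 ("maximum degree `d`")] -/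
theorem slyGadget_degree_le (hq : 0 < q) (x : SlyV n m D q) :
    (slyGadgetGraph n m D q σ τ).degree x ≤ q + 1 := by
  classical
  rcases x with (w | t) | (w | t)
  · exact slyGadget_degree_plusW σ τ w
  · exact (slyGadget_degree_plusT_le σ τ hq t).trans (Nat.add_le_add_left (card_parent_le t) q)
  · exact slyGadget_degree_minusW σ τ w
  · exact (slyGadget_degree_minusT_le σ τ hq t).trans (Nat.add_le_add_left (card_parent_le t) q)

/-- **Sly's gadget has maximum degree `≤ q + 1 = d`.** [cite: Sly2010, §2.1] -/
theorem slyGadget_maxDegree_le (hq : 0 < q) : (slyGadgetGraph n m D q σ τ).maxDegree ≤ q + 1 :=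
  (slyGadgetGraph n m D q σ τ).maxDegree_le_of_forall_degree_le (q + 1) fun x => slyGadget_degree_le σ τ hq x

/-- **The ports (roots) of the plus half have degree `≤ q = d - 1`.** [cite: Sly2010, §2.1] -/
theorem slyGadget_degree_plusRoot (hq : 0 < q) (j : Fin m) :
    (slyGadgetGraph n m D q σ τ).degree (Sum.inl (Sum.inr (slyRoot m D q j))) ≤ q := by
  classical
  have h := slyGadget_degree_plusT_le σ τ hq (slyRoot m D q j)
  have h0 : (univ.filter fun t₀ => SlyIsChild q t₀ (slyRoot m D q j)).card = 0 :=
    card_eq_zero.2 (filter_eq_empty_iff.2 fun t₀ _ => not_isChild_root (by simp [slyRoot]) t₀)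
  simpa [h0] using h

/-- **The ports (roots) of the minus half have degree `≤ q = d - 1`.** [cite: Sly2010, §2.1] -/
theorem slyGadget_degree_minusRoot (hq : 0 < q) (j : Fin m) :
    (slyGadgetGraph n m D q σ τ).degree (Sum.inr (Sum.inr (slyRoot m D q j))) ≤ q := by
  classical
  have h := slyGadget_degree_minusT_le σ τ hq (slyRoot m D q j)
  have h0 : (univ.filter fun t₀ => SlyIsChild q t₀ (slyRoot m D q j)).card = 0 :=
    card_eq_zero.2 (filter_eq_empty_iff.2 fun t₀ _ => not_isChild_root (by simp [slyRoot]) t₀)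
  simpa [h0] using h

end Degrees

/-! #### Vertex count -/

/-- The forest has at most `(D+1) m q^D` vertices (for `q ≥ 1`). [folklore] -/
theorem card_slyTreeV_le (hq : 0 < q) (m D : ℕ) :
    Fintype.card (SlyTreeV m D q) ≤ (D + 1) * (m * q ^ D) := by
  rw [card_slyTreeV]
  calc ∑ l : Fin (D + 1), m * q ^ (l : ℕ) ≤ ∑ _l : Fin (D + 1), m * q ^ D :=
        sum_le_sum fun l _ => Nat.mul_le_mul_left m (Nat.pow_le_pow_right hq (Nat.lt_succ_iff.1 l.isLt))
    _ = (D + 1) * (m * q ^ D) := by simp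

/-- **Sly's gadget has `2n + 2·#forest ≤ 2n + 2(D+1) m q^D` vertices.** [cite: Sly2010, §2.1] -/
theorem card_slyV_le (hq : 0 < q) (n m D : ℕ) :
    Fintype.card (SlyV n m D q) ≤ 2 * n + 2 * ((D + 1) * (m * q ^ D)) := by
  have h := card_slyTreeV_le hq m D
  simp only [Fintype.card_sum, Fintype.card_fin]
  omega

/-! #### The gadget over `Fin v` (the form used in `slyGadgetReduction`) -/

section FinModel
variable (n m D q : ℕ)

/-- A numbering of the vertices of Sly's gadget by `Fin v`, `v = #SlyV`. [folklore] -/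
noncomputable def slyNum : SlyV n m D q ≃ Fin (Fintype.card (SlyV n m D q)) :=
  Fintype.equivFinOfCardEq rfl

variable (σ : Fin q → Equiv.Perm (Fin (n + m * q ^ D))) (τ : Equiv.Perm (Fin n))

/-- **Sly's gadget `G(n, θ, ψ)` as a simple graph on `Fin v`.** [cite: Sly2010, §2.1] -/
noncomputable def slyGadgetFin : SimpleGraph (Fin (Fintype.card (SlyV n m D q))) :=
  (slyGadgetGraph n m D q σ τ).map (slyNum n m D q)

/-- The numbering is a graph isomorphism. [folklore] -/
noncomputable def slyGadgetFinIso : slyGadgetGraph n m D q σ τ ≃g slyGadgetFin n m D q σ τ :=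
  SimpleGraph.Iso.map (slyNum n m D q) _

/-- The plus ports `V⁺` (roots of the plus forest), as an embedding `Fin m ↪ Fin v`. [cite: Sly2010, §2.1] -/
noncomputable def slyPortPlus : Fin m ↪ Fin (Fintype.card (SlyV n m D q)) :=
  ⟨fun j => slyNum n m D q (Sum.inl (Sum.inr (slyRoot m D q j))), fun j j' h => by
    simpa using slyRoot_injective m D q (by simpa using h)⟩

/-- The minus ports `V⁻`. [cite: Sly2010, §2.1] -/
noncomputable def slyPortMinus : Fin m ↪ Fin (Fintype.card (SlyV n m D q)) :=
  ⟨fun j => slyNum n m D q (Sum.inr (Sum.inr (slyRoot m D q j))), fun j j' h => by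
    simpa using slyRoot_injective m D q (by simpa using h)⟩

/-- The vertex set `W⁺`. [cite: Sly2010, §2.1] -/
noncomputable def slyWPlus : Finset (Fin (Fintype.card (SlyV n m D q))) :=
  univ.map ⟨fun w : Fin n => slyNum n m D q (Sum.inl (Sum.inl w)), fun w w' h => by simpa using h⟩

/-- The vertex set `W⁻`. [cite: Sly2010, §2.1] -/
noncomputable def slyWMinus : Finset (Fin (Fintype.card (SlyV n m D q))) :=
  univ.map ⟨fun w : Fin n => slyNum n m D q (Sum.inr (Sum.inl w)), fun w w' h => by simpa using h⟩

/-- Unfolding lemma for `slyPortPlus`. [folklore] -/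
theorem slyPortPlus_apply (j : Fin m) :
    slyPortPlus n m D q j = slyNum n m D q (Sum.inl (Sum.inr (slyRoot m D q j))) := rfl

/-- Unfolding lemma for `slyPortMinus`. [folklore] -/
theorem slyPortMinus_apply (j : Fin m) :
    slyPortMinus n m D q j = slyNum n m D q (Sum.inr (Sum.inr (slyRoot m D q j))) := rfl

/-- Membership in `W⁺` over `Fin v`. [folklore] -/
theorem mem_slyWPlus {x : Fin (Fintype.card (SlyV n m D q))} :
    x ∈ slyWPlus n m D q ↔ ∃ w : Fin n, slyNum n m D q (Sum.inl (Sum.inl w)) = x := by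
  simp [slyWPlus]

/-- Membership in `W⁻` over `Fin v`. [folklore] -/
theorem mem_slyWMinus {x : Fin (Fintype.card (SlyV n m D q))} :
    x ∈ slyWMinus n m D q ↔ ∃ w : Fin n, slyNum n m D q (Sum.inr (Sum.inl w)) = x := by
  simp [slyWMinus]

/-- `|W⁺| = n`. [cite: Sly2010, §2.1] -/
theorem card_slyWPlus : (slyWPlus n m D q).card = n := by simp [slyWPlus]

/-- `|W⁻| = n`. [cite: Sly2010, §2.1] -/
theorem card_slyWMinus : (slyWMinus n m D q).card = n := by simp [slyWMinus]

/-- `W⁺` and `W⁻` are disjoint. [folklore] -/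
theorem disjoint_slyW : Disjoint (slyWPlus n m D q) (slyWMinus n m D q) := by
  rw [Finset.disjoint_left]
  rintro x h1 h2
  obtain ⟨w, rfl⟩ := (mem_slyWPlus n m D q).1 h1
  obtain ⟨w', h⟩ := (mem_slyWMinus n m D q).1 h2
  simp at h

/-- `V⁺` and `V⁻` are disjoint. [folklore] -/
theorem disjoint_slyPort :
    Disjoint (Set.range (slyPortPlus n m D q)) (Set.range (slyPortMinus n m D q)) := by
  rw [Set.disjoint_left]
  rintro x ⟨j, rfl⟩ ⟨j', h⟩
  simp [slyPortPlus_apply, slyPortMinus_apply] at h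

/-- The ports avoid `W^{±}`. [folklore] -/
theorem slyPortPlus_not_mem_W (j : Fin m) :
    slyPortPlus n m D q j ∉ slyWPlus n m D q ∧ slyPortPlus n m D q j ∉ slyWMinus n m D q := by
  constructor
  · intro h; obtain ⟨w, hw⟩ := (mem_slyWPlus n m D q).1 h; simp [slyPortPlus_apply] at hw
  · intro h; obtain ⟨w, hw⟩ := (mem_slyWMinus n m D q).1 h; simp [slyPortPlus_apply] at hw

/-- The minus ports avoid `W^{±}`. [folklore] -/
theorem slyPortMinus_not_mem_W (j : Fin m) :
    slyPortMinus n m D q j ∉ slyWPlus n m D q ∧ slyPortMinus n m D q j ∉ slyWMinus n m D q := by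
  constructor
  · intro h; obtain ⟨w, hw⟩ := (mem_slyWPlus n m D q).1 h; simp [slyPortMinus_apply] at hw
  · intro h; obtain ⟨w, hw⟩ := (mem_slyWMinus n m D q).1 h; simp [slyPortMinus_apply] at hw

open scoped Classical in
/-- **`G(n, θ, ψ)` over `Fin v` has maximum degree `≤ q + 1 = d`.** [cite: Sly2010, §2.1] -/
theorem slyGadgetFin_maxDegree_le (hq : 0 < q) : (slyGadgetFin n m D q σ τ).maxDegree ≤ q + 1 := by
  rw [← (slyGadgetFinIso n m D q σ τ).maxDegree_eq]
  exact slyGadget_maxDegree_le σ τ hq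

open scoped Classical in
/-- **The plus ports have degree `≤ q = d - 1` in `G(n, θ, ψ)` over `Fin v`.** [cite: Sly2010, §2.1] -/
theorem slyGadgetFin_degree_portPlus (hq : 0 < q) (j : Fin m) :
    (slyGadgetFin n m D q σ τ).degree (slyPortPlus n m D q j) ≤ q := by
  have h := (slyGadgetFinIso n m D q σ τ).degree_eq (Sum.inl (Sum.inr (slyRoot m D q j)))
  rw [slyPortPlus_apply, show slyNum n m D q (Sum.inl (Sum.inr (slyRoot m D q j))) =
    slyGadgetFinIso n m D q σ τ (Sum.inl (Sum.inr (slyRoot m D q j))) from rfl]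
  convert (le_of_eq h).trans (slyGadget_degree_plusRoot σ τ hq j)

open scoped Classical in
/-- **The minus ports have degree `≤ q = d - 1`.** [cite: Sly2010, §2.1] -/
theorem slyGadgetFin_degree_portMinus (hq : 0 < q) (j : Fin m) :
    (slyGadgetFin n m D q σ τ).degree (slyPortMinus n m D q j) ≤ q := by
  have h := (slyGadgetFinIso n m D q σ τ).degree_eq (Sum.inr (Sum.inr (slyRoot m D q j)))
  rw [slyPortMinus_apply, show slyNum n m D q (Sum.inr (Sum.inr (slyRoot m D q j))) =
    slyGadgetFinIso n m D q σ τ (Sum.inr (Sum.inr (slyRoot m D q j))) from rfl]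
  convert (le_of_eq h).trans (slyGadget_degree_minusRoot σ τ hq j)

end FinModel

/-! #### Sly's parameters: `q = d - 1`, `m = slyM d θ n` trees of depth `D = 2⌊(ψ/2) log_{d-1} n⌋` -/

section Parameters

open Filter Topology Asymptotics

/-- **The depth of the appended trees**, `D = 2⌊(ψ/2) log_{Δ-1} n⌋` (even, for the two-stage
reconstruction argument of §4.2). [cite: Sly2010, §2.1 (construction of `G`)] -/
noncomputable def slyDepth (Δ : ℕ) (ψ : ℝ) (n : ℕ) : ℕ :=
  2 * ⌊ψ / 2 * Real.logb ((Δ : ℝ) - 1) n⌋₊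

/-- Unfolding lemma for `slyDepth`. [cite: Sly2010, §2.1] -/
theorem slyDepth_def (Δ : ℕ) (ψ : ℝ) (n : ℕ) :
    slyDepth Δ ψ n = 2 * ⌊ψ / 2 * Real.logb ((Δ : ℝ) - 1) n⌋₊ := rfl

/-- `(Δ-1)^{x} = n^{x / log…}`: the base change `(Δ-1)^{c log_{Δ-1} n} = n^c`. [folklore] -/
theorem rpow_mul_logb_eq {Δ : ℕ} (hΔ : 3 ≤ Δ) {n : ℕ} (hn : 1 ≤ n) (c : ℝ) :
    (((Δ : ℝ) - 1) ^ (c * Real.logb ((Δ : ℝ) - 1) n) : ℝ) = (n : ℝ) ^ c := by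
  have hq1 : (1 : ℝ) < (Δ : ℝ) - 1 := by
    have : (3 : ℝ) ≤ Δ := by exact_mod_cast hΔ
    linarith
  have hq0 : (0 : ℝ) < (Δ : ℝ) - 1 := by linarith
  have hn0 : (0 : ℝ) < n := by exact_mod_cast hn
  rw [mul_comm, Real.rpow_mul hq0.le, Real.rpow_logb hq0 hq1.ne' hn0]

/-- `m = slyM Δ θ n ≤ n^θ`. [cite: Sly2010, §2.1] -/
theorem slyM_le_rpow {Δ : ℕ} (hΔ : 3 ≤ Δ) {θ : ℝ} (hθ : 0 ≤ θ) {n : ℕ} (hn : 1 ≤ n) :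
    (slyM Δ θ n : ℝ) ≤ (n : ℝ) ^ θ := by
  have hq1 : (1 : ℝ) < (Δ : ℝ) - 1 := by
    have : (3 : ℝ) ≤ Δ := by exact_mod_cast hΔ
    linarith
  have hL : 0 ≤ Real.logb ((Δ : ℝ) - 1) n := Real.logb_nonneg hq1 (by exact_mod_cast hn)
  unfold slyM
  have hcast : ((Δ - 1 : ℕ) : ℝ) = (Δ : ℝ) - 1 := by
    rw [Nat.cast_sub (by omega)]; simp
  rw [Nat.cast_pow, hcast, ← rpow_mul_logb_eq hΔ hn θ, ← Real.rpow_natCast]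
  exact Real.rpow_le_rpow_of_exponent_le hq1.le (Nat.floor_le (mul_nonneg hθ hL))

/-- `(Δ-1)^D ≤ n^ψ` for `D = slyDepth Δ ψ n`. [cite: Sly2010, §2.1] -/
theorem pow_slyDepth_le_rpow {Δ : ℕ} (hΔ : 3 ≤ Δ) {ψ : ℝ} (hψ : 0 ≤ ψ) {n : ℕ} (hn : 1 ≤ n) :
    (((Δ - 1) ^ slyDepth Δ ψ n : ℕ) : ℝ) ≤ (n : ℝ) ^ ψ := by
  have hq1 : (1 : ℝ) < (Δ : ℝ) - 1 := by
    have : (3 : ℝ) ≤ Δ := by exact_mod_cast hΔ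
    linarith
  have hL : 0 ≤ Real.logb ((Δ : ℝ) - 1) n := Real.logb_nonneg hq1 (by exact_mod_cast hn)
  have hcast : ((Δ - 1 : ℕ) : ℝ) = (Δ : ℝ) - 1 := by
    rw [Nat.cast_sub (by omega)]; simp
  rw [Nat.cast_pow, hcast, ← rpow_mul_logb_eq hΔ hn ψ, ← Real.rpow_natCast]
  refine Real.rpow_le_rpow_of_exponent_le hq1.le ?_
  rw [slyDepth_def, Nat.cast_mul, Nat.cast_two]
  have := Nat.floor_le (mul_nonneg (by linarith : 0 ≤ ψ / 2) hL)
  linarith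

/-- `D + 1 ≤ ψ log_{Δ-1} n + 1`. [folklore] -/
theorem slyDepth_le {Δ : ℕ} (hΔ : 3 ≤ Δ) {ψ : ℝ} (hψ : 0 ≤ ψ) {n : ℕ} (hn : 1 ≤ n) :
    (slyDepth Δ ψ n : ℝ) ≤ ψ * Real.logb ((Δ : ℝ) - 1) n := by
  have hq1 : (1 : ℝ) < (Δ : ℝ) - 1 := by
    have : (3 : ℝ) ≤ Δ := by exact_mod_cast hΔ
    linarith
  have hL : 0 ≤ Real.logb ((Δ : ℝ) - 1) n := Real.logb_nonneg hq1 (by exact_mod_cast hn)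
  rw [slyDepth_def, Nat.cast_mul, Nat.cast_two]
  have := Nat.floor_le (mul_nonneg (by linarith : 0 ≤ ψ / 2) hL)
  linarith

/-- **The gadget has at most `3n` vertices for large `n`**: with `q = Δ - 1`, `m = slyM Δ θ n` and
`D = slyDepth Δ ψ n`, `2n + 2(D+1) m q^D ≤ 3n` eventually, since `(D+1) m q^D ≤ (ψ log_q n + 1) n^{θ+ψ}`
and `θ + ψ < 1` ("`G` has … `O(n + n^{θ+ψ} log n) ≤ 3n` vertices for large `n`").
[cite: Sly2010, §2.1–2.2 (size of `G`; "`H^G` has at most `3n²` vertices")] -/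
theorem sly_vertexBound_eventually {Δ : ℕ} (hΔ : 3 ≤ Δ) {θ ψ : ℝ} (hθ : 0 < θ) (hψ : 0 < ψ)
    (hθψ : θ + ψ < 1) :
    ∀ᶠ n : ℕ in atTop,
      ((2 * n + 2 * ((slyDepth Δ ψ n + 1) * (slyM Δ θ n * (Δ - 1) ^ slyDepth Δ ψ n)) : ℕ) : ℝ) ≤
        3 * n := by
  have hq1 : (1 : ℝ) < (Δ : ℝ) - 1 := by
    have : (3 : ℝ) ≤ Δ := by exact_mod_cast hΔ
    linarith
  have hlogq : Real.log 2 ≤ Real.log ((Δ : ℝ) - 1) := by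
    apply Real.log_le_log two_pos
    have : (3 : ℝ) ≤ Δ := by exact_mod_cast hΔ
    linarith
  have hlog2 : (1 : ℝ) / 2 < Real.log 2 := by
    have := Real.log_two_gt_d9; norm_num at this ⊢; linarith
  set ε : ℝ := 1 - θ - ψ with hε
  have hε0 : 0 < ε := by linarith
  -- `log n ≤ n^ε / 8` and `2 ≤ n^ε / 2` eventually
  have ev1 : ∀ᶠ n : ℕ in atTop, Real.log n ≤ (n : ℝ) ^ ε / 8 := by
    have h := (isLittleO_log_rpow_atTop hε0).def (by norm_num : (0 : ℝ) < 1 / 8)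
    have h' := tendsto_natCast_atTop_atTop (R := ℝ) |>.eventually h
    filter_upwards [h', eventually_ge_atTop 1] with n hn hn1
    have hn0 : (0 : ℝ) ≤ Real.log n := Real.log_nonneg (by exact_mod_cast hn1)
    rw [Real.norm_of_nonneg hn0, Real.norm_of_nonneg (by positivity)] at hn
    linarith
  have ev2 : ∀ᶠ n : ℕ in atTop, (4 : ℝ) ≤ (n : ℝ) ^ ε :=
    ((tendsto_rpow_atTop hε0).comp tendsto_natCast_atTop_atTop).eventually (eventually_ge_atTop 4)
  filter_upwards [ev1, ev2, eventually_ge_atTop 1] with n h1 h2 hn1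
  have hn0 : (0 : ℝ) < n := by exact_mod_cast hn1
  have hL0 : 0 ≤ Real.logb ((Δ : ℝ) - 1) n := Real.logb_nonneg hq1 (by exact_mod_cast hn1)
  -- `L = log n / log q ≤ 2 log n`
  have hL : Real.logb ((Δ : ℝ) - 1) n ≤ 2 * Real.log n := by
    rw [Real.logb, div_le_iff₀ (by linarith)]
    have hlogn : 0 ≤ Real.log n := Real.log_nonneg (by exact_mod_cast hn1)
    nlinarith
  have hm := slyM_le_rpow hΔ hθ.le hn1
  have hD := pow_slyDepth_le_rpow hΔ hψ.le hn1
  have hD1 := slyDepth_le hΔ hψ.le hn1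
  have hmq : ((slyM Δ θ n * (Δ - 1) ^ slyDepth Δ ψ n : ℕ) : ℝ) ≤ (n : ℝ) ^ (θ + ψ) := by
    rw [Nat.cast_mul, Real.rpow_add hn0]
    exact mul_le_mul hm hD (by positivity) (by positivity)
  have hprod : (((slyDepth Δ ψ n + 1) * (slyM Δ θ n * (Δ - 1) ^ slyDepth Δ ψ n) : ℕ) : ℝ) ≤
      (2 * Real.log n + 1) * (n : ℝ) ^ (θ + ψ) := by
    rw [Nat.cast_mul]
    refine mul_le_mul ?_ hmq (by positivity) (by positivity)
    push_cast
    have : ψ * Real.logb ((Δ : ℝ) - 1) n ≤ 1 * (2 * Real.log n) :=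
      mul_le_mul (by linarith) hL hL0 zero_le_one
    linarith
  -- assemble: `2 (2 log n + 1) n^{θ+ψ} ≤ n^ε n^{θ+ψ} = n`
  have hkey : 2 * ((2 * Real.log n + 1) * (n : ℝ) ^ (θ + ψ)) ≤ n := by
    have h3 : 2 * (2 * Real.log n + 1) ≤ (n : ℝ) ^ ε := by linarith
    calc 2 * ((2 * Real.log n + 1) * (n : ℝ) ^ (θ + ψ))
        = 2 * (2 * Real.log n + 1) * (n : ℝ) ^ (θ + ψ) := by ring
      _ ≤ (n : ℝ) ^ ε * (n : ℝ) ^ (θ + ψ) := mul_le_mul_of_nonneg_right h3 (by positivity)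
      _ = n := by
        rw [← Real.rpow_add hn0, hε, show 1 - θ - ψ + (θ + ψ) = (1 : ℝ) by ring, Real.rpow_one]
  push_cast at hprod ⊢
  linarith

end Parameters

/-! #### The cut at `U`: core weights `Z^{±}_{G̃}(η)` and forest weights `κ(η)` (Sly §4.1) -/

section Cut

/-- **Independence in the core `G̃(σ, τ)`** of a configuration occupying `S ⊆ W⁺`, `T ⊆ W⁻`,
`E⁺ ⊆ U⁺`, `E⁻ ⊆ U⁻` (halves numbered by `Fin (n + m')`, `W` first): no big matching `σ_i` joins an
occupied plus vertex to an occupied minus vertex, and the small matching `τ` joins no `s ∈ S` to `T` —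
the event averaged in `sly_firstMoment`. [cite: Sly2010, §2.1 (construction of `G̃`), §3 (proof of Lemma 3.1)] -/
def SlyCoreIndep {n m' k : ℕ} (σ : Fin k → Equiv.Perm (Fin (n + m'))) (τ : Equiv.Perm (Fin n))
    (S T : Finset (Fin n)) (Ep Em : Finset (Fin m')) : Prop :=
  (∀ i, ∀ v ∈ S.map (Fin.castAddEmb m') ∪ Ep.map (Fin.natAddEmb n),
      σ i v ∉ T.map (Fin.castAddEmb m') ∪ Em.map (Fin.natAddEmb n)) ∧
    ∀ s ∈ S, τ s ∉ T

open scoped Classical in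
/-- **`Z^{s}_{G̃}(η)` for a realisation `(σ, τ)` of the core** (Sly's `Z^{±}_{G̃}(η)` before taking
expectations): the total weight `λ^{|S|+|T|+|E⁺|+|E⁻|}` of the configurations `(S ⊆ W⁺, T ⊆ W⁻)` that
together with the boundary configuration `η = (E⁺, E⁻)` on `U` are independent in `G̃(σ, τ)` and have
phase `s` (`+` = `true` iff `|T| ≤ |S|`). Its average over `(σ, τ)` is `Σ_{a ≥ b}` (resp. `Σ_{a < b}`)
of `sly_firstMoment`, i.e. `slyZplus`/`slyZminus`. [cite: Sly2010, §3 (definition of `Z^{±}_{G̃}(η)`)] -/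
noncomputable def slyCoreZ {n m' k : ℕ} (σ : Fin k → Equiv.Perm (Fin (n + m'))) (τ : Equiv.Perm (Fin n))
    (lam : ℝ) (s : Bool) (Ep Em : Finset (Fin m')) : ℝ :=
  ∑ S : Finset (Fin n), ∑ T : Finset (Fin n),
    if decide (T.card ≤ S.card) = s ∧ SlyCoreIndep σ τ S T Ep Em then
      lam ^ (S.card + T.card + Ep.card + Em.card) else 0

/-- **Independence inside the forest**: no vertex of `K` is a child of another. [folklore] -/
def SlyForestIndep {m D : ℕ} (q : ℕ) (K : Finset (SlyTreeV m D q)) : Prop :=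
  ∀ t ∈ K, ∀ t' ∈ K, ¬SlyIsChild q t t'

open scoped Classical in
/-- **The forest weight `κ_S(E)` of one half** (Sly's `κ(η) = Σ_{σ ∈ I_η(G ∖ G̃)} λ^{|σ|}`, refined
by the configuration on the ports): the total weight `λ^{#(internal vertices of K)}` of the independent
sets `K` of the forest whose leaves are exactly `leaves(E)` and whose occupied roots are exactly `S`
(so `K = σ ∪ leaves(E)` with `σ ∈ I_η(G ∖ G̃)` a configuration on the internal vertices, levels `< D`).
[cite: Sly2010, §4.1 (definition of `κ(η)`)] -/
noncomputable def slyForestZ (m D q : ℕ) (lam : ℝ) (E : Finset (Fin (m * q ^ D))) (S : Finset (Fin m)) : ℝ :=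
  ∑ K : Finset (SlyTreeV m D q),
    if (∀ u, slyLeaf m D q u ∈ K ↔ u ∈ E) ∧ SlyForestIndep q K ∧ (∀ j, slyRoot m D q j ∈ K ↔ j ∈ S) then
      lam ^ (K.filter fun t => (t.1.1 : ℕ) < D).card else 0

/-- `slyCoreZ ≥ 0` for `λ ≥ 0`. [folklore] -/
theorem slyCoreZ_nonneg {n m' k : ℕ} (σ : Fin k → Equiv.Perm (Fin (n + m'))) (τ : Equiv.Perm (Fin n))
    {lam : ℝ} (hlam : 0 ≤ lam) (s : Bool) (Ep Em : Finset (Fin m')) : 0 ≤ slyCoreZ σ τ lam s Ep Em := by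
  classical
  unfold slyCoreZ
  exact sum_nonneg fun _ _ => sum_nonneg fun _ _ => by split_ifs <;> positivity

/-- `slyForestZ ≥ 0` for `λ ≥ 0`. [folklore] -/
theorem slyForestZ_nonneg (m D q : ℕ) {lam : ℝ} (hlam : 0 ≤ lam) (E : Finset (Fin (m * q ^ D)))
    (S : Finset (Fin m)) : 0 ≤ slyForestZ m D q lam E S := by
  classical
  unfold slyForestZ
  exact sum_nonneg fun _ _ => by split_ifs <;> positivity

end Cut

/-! #### The decomposition of `Z_G` over the cut at `U` (Sly §4.1, "`E Z^{±}_G = Σ_η E Z^{±}_{G̃}(η) κ(η)`") -/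

section CutDecomposition

variable (σ : Fin q → Equiv.Perm (Fin (n + m * q ^ D))) (τ : Equiv.Perm (Fin n))

/-- Related vertices are distinct (so `fromRel` loses nothing). [folklore] -/
theorem SlyRel.ne {x y : SlyV n m D q} (h : SlyRel n m D q σ τ x y) : x ≠ y := by
  rcases h with ⟨k, i, rfl, rfl⟩ | ⟨w, rfl, rfl⟩ | ⟨t, t', hc, ⟨rfl, rfl⟩ | ⟨rfl, rfl⟩⟩
  · simp
  · simp
  · have : t ≠ t' := by rintro rfl; exact absurd hc.1 (by omega)
    simpa using this
  · have : t ≠ t' := by rintro rfl; exact absurd hc.1 (by omega)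
    simpa using this

/-- Independence in the gadget: no two occupied vertices are related by `SlyRel`. [folklore] -/
theorem isIndepSet_slyGadget_iff (I : Finset (SlyV n m D q)) :
    (slyGadgetGraph n m D q σ τ).IsIndepSet ↑I ↔ ∀ x ∈ I, ∀ y ∈ I, ¬SlyRel n m D q σ τ x y := by
  constructor
  · intro h x hx y hy hr
    exact h (Finset.mem_coe.2 hx) (Finset.mem_coe.2 hy) (SlyRel.ne σ τ hr) ⟨SlyRel.ne σ τ hr, Or.inl hr⟩
  · intro h x hx y hy _ hadj
    rcases hadj with ⟨-, hr | hr⟩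
    · exact h x hx y hy hr
    · exact h y hy x hx hr

/-- The leaves occupied by a forest configuration, as a subset of `Fin (m q^D)`. [folklore] -/
noncomputable def slyLeafPart (K : Finset (SlyTreeV m D q)) : Finset (Fin (m * q ^ D)) :=
  univ.filter fun u => slyLeaf m D q u ∈ K

/-- Membership in the leaf part. [folklore] -/
theorem mem_slyLeafPart {K : Finset (SlyTreeV m D q)} {u : Fin (m * q ^ D)} :
    u ∈ slyLeafPart K ↔ slyLeaf m D q u ∈ K := by
  simp [slyLeafPart]

/-- The leaf condition in `slyForestZ` says `E = slyLeafPart K`. [folklore] -/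
theorem slyLeafPart_eq_iff (K : Finset (SlyTreeV m D q)) (E : Finset (Fin (m * q ^ D))) :
    (∀ u, slyLeaf m D q u ∈ K ↔ u ∈ E) ↔ E = slyLeafPart K := by
  constructor
  · intro h; ext u; rw [mem_slyLeafPart, h]
  · rintro rfl u; rw [mem_slyLeafPart]

/-- `#K = #(internal vertices of K) + #(leaves of K)`. [folklore] -/
theorem card_eq_internal_add_leafPart (K : Finset (SlyTreeV m D q)) :
    K.card = (K.filter fun t => (t.1.1 : ℕ) < D).card + (slyLeafPart K).card := by
  classical
  rw [← Finset.card_filter_add_card_filter_not (p := fun t : SlyTreeV m D q => (t.1.1 : ℕ) < D)]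
  congr 1
  have : (K.filter fun t : SlyTreeV m D q => ¬(t.1.1 : ℕ) < D) =
      (slyLeafPart K).map ⟨slyLeaf m D q, slyLeaf_injective m D q⟩ := by
    ext t
    simp only [mem_filter, not_lt, mem_map, Function.Embedding.coeFn_mk, mem_slyLeafPart]
    constructor
    · rintro ⟨ht, hl⟩
      have hD : (t.1.1 : ℕ) = D := le_antisymm (Nat.lt_succ_iff.1 t.1.1.isLt) hl
      obtain ⟨u, rfl⟩ := exists_slyLeaf_of_level hD
      exact ⟨u, ht, rfl⟩
    · rintro ⟨u, hu, rfl⟩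
      exact ⟨hu, (slyLeaf_level u).ge⟩
  rw [this, card_map]

/-- The matched vertex `i` of the plus half is occupied in `I = (S ⊔ K⁺) ⊔ (T ⊔ K⁻)` iff
`i ∈ S ∪ leaves(K⁺)` (as subsets of `Fin (n + m')`). [folklore] -/
theorem inl_slyMatchVertex_mem_iff (S T : Finset (Fin n)) (Kp Km : Finset (SlyTreeV m D q))
    (i : Fin (n + m * q ^ D)) :
    (Sum.inl (slyMatchVertex n m D q i) : SlyV n m D q) ∈ (S.disjSum Kp).disjSum (T.disjSum Km) ↔
      i ∈ S.map (Fin.castAddEmb (m * q ^ D)) ∪ (slyLeafPart Kp).map (Fin.natAddEmb n) := by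
  rw [Finset.inl_mem_disjSum]
  unfold slyMatchVertex
  rcases hx : finSumFinEquiv.symm i with w | u
  · have hi : i = Fin.castAdd (m * q ^ D) w := by
      rw [← finSumFinEquiv_apply_left, ← hx, Equiv.apply_symm_apply]
    subst hi
    simp only [Sum.elim_inl, Finset.inl_mem_disjSum, mem_union, mem_map, Fin.castAddEmb_apply,
      Fin.natAddEmb_apply]
    constructor
    · intro h; exact Or.inl ⟨w, h, rfl⟩
    · rintro (⟨w', hw', he⟩ | ⟨u, -, hu⟩)
      · rwa [← Fin.castAdd_inj.1 he]
      · exact absurd (congrArg Fin.val hu) (by simp; omega)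
  · have hi : i = Fin.natAdd n u := by
      rw [← finSumFinEquiv_apply_right, ← hx, Equiv.apply_symm_apply]
    subst hi
    simp only [Sum.elim_inr, Finset.inr_mem_disjSum, mem_union, mem_map, Fin.castAddEmb_apply,
      Fin.natAddEmb_apply, mem_slyLeafPart]
    constructor
    · intro h; exact Or.inr ⟨u, h, rfl⟩
    · rintro (⟨w', -, he⟩ | ⟨u', hu', he⟩)
      · exact absurd (congrArg Fin.val he) (by simp; omega)
      · rwa [← (Fin.natAdd_inj n).1 he]

/-- The matched vertex `i` of the minus half is occupied in `I = (S ⊔ K⁺) ⊔ (T ⊔ K⁻)` iff `i ∈ T ∪ leaves(K⁻)`. [folklore] -/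
theorem inr_slyMatchVertex_mem_iff (S T : Finset (Fin n)) (Kp Km : Finset (SlyTreeV m D q))
    (i : Fin (n + m * q ^ D)) :
    (Sum.inr (slyMatchVertex n m D q i) : SlyV n m D q) ∈ (S.disjSum Kp).disjSum (T.disjSum Km) ↔
      i ∈ T.map (Fin.castAddEmb (m * q ^ D)) ∪ (slyLeafPart Km).map (Fin.natAddEmb n) := by
  rw [Finset.inr_mem_disjSum]
  unfold slyMatchVertex
  rcases hx : finSumFinEquiv.symm i with w | u
  · have hi : i = Fin.castAdd (m * q ^ D) w := by
      rw [← finSumFinEquiv_apply_left, ← hx, Equiv.apply_symm_apply]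
    subst hi
    simp only [Sum.elim_inl, Finset.inl_mem_disjSum, mem_union, mem_map, Fin.castAddEmb_apply,
      Fin.natAddEmb_apply]
    constructor
    · intro h; exact Or.inl ⟨w, h, rfl⟩
    · rintro (⟨w', hw', he⟩ | ⟨u, -, hu⟩)
      · rwa [← Fin.castAdd_inj.1 he]
      · exact absurd (congrArg Fin.val hu) (by simp; omega)
  · have hi : i = Fin.natAdd n u := by
      rw [← finSumFinEquiv_apply_right, ← hx, Equiv.apply_symm_apply]
    subst hi
    simp only [Sum.elim_inr, Finset.inr_mem_disjSum, mem_union, mem_map, Fin.castAddEmb_apply,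
      Fin.natAddEmb_apply, mem_slyLeafPart]
    constructor
    · intro h; exact Or.inr ⟨u, h, rfl⟩
    · rintro (⟨w', -, he⟩ | ⟨u', hu', he⟩)
      · exact absurd (congrArg Fin.val he) (by simp; omega)
      · rwa [← (Fin.natAdd_inj n).1 he]

/-- **Independence splits over the cut**: `I = (S ⊔ K⁺) ⊔ (T ⊔ K⁻)` is independent in the gadget iff
the core configuration `(S, T, leaves(K⁺), leaves(K⁻))` is independent in `G̃(σ, τ)` and `K⁺`, `K⁻` are
independent in the forests. [folklore] -/
theorem isIndepSet_disjSum_iff (S T : Finset (Fin n)) (Kp Km : Finset (SlyTreeV m D q)) :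
    (slyGadgetGraph n m D q σ τ).IsIndepSet ↑((S.disjSum Kp).disjSum (T.disjSum Km)) ↔
      SlyCoreIndep σ τ S T (slyLeafPart Kp) (slyLeafPart Km) ∧ SlyForestIndep q Kp ∧ SlyForestIndep q Km := by
  rw [isIndepSet_slyGadget_iff]
  constructor
  · intro h
    refine ⟨⟨fun k v hv hσ => ?_, fun w hw hτ => ?_⟩, fun t ht t' ht' hc => ?_, fun t ht t' ht' hc => ?_⟩
    · exact h _ ((inl_slyMatchVertex_mem_iff S T Kp Km v).2 hv) _
        ((inr_slyMatchVertex_mem_iff S T Kp Km (σ k v)).2 hσ) (Or.inl ⟨k, v, rfl, rfl⟩)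
    · exact h (Sum.inl (Sum.inl w)) (by simpa using hw) (Sum.inr (Sum.inl (τ w))) (by simpa using hτ)
        (Or.inr (Or.inl ⟨w, rfl, rfl⟩))
    · exact h (Sum.inl (Sum.inr t)) (by simpa using ht) (Sum.inl (Sum.inr t')) (by simpa using ht')
        (Or.inr (Or.inr ⟨t, t', hc, Or.inl ⟨rfl, rfl⟩⟩))
    · exact h (Sum.inr (Sum.inr t)) (by simpa using ht) (Sum.inr (Sum.inr t')) (by simpa using ht')
        (Or.inr (Or.inr ⟨t, t', hc, Or.inr ⟨rfl, rfl⟩⟩))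
  · rintro ⟨⟨hbig, hsmall⟩, hKp, hKm⟩ x hx y hy hr
    rcases hr with ⟨k, i, rfl, rfl⟩ | ⟨w, rfl, rfl⟩ | ⟨t, t', hc, ⟨rfl, rfl⟩ | ⟨rfl, rfl⟩⟩
    · exact hbig k i ((inl_slyMatchVertex_mem_iff S T Kp Km i).1 hx)
        ((inr_slyMatchVertex_mem_iff S T Kp Km _).1 hy)
    · exact hsmall w (by simpa using hx) (by simpa using hy)
    · exact hKp t (by simpa using hx) t' (by simpa using hy) hc
    · exact hKm t (by simpa using hx) t' (by simpa using hy) hc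

/-- `W⁺`, `W⁻` and the ports, on the vertex type `SlyV`. [folklore] -/
def slyWp (n m D q : ℕ) : Finset (SlyV n m D q) :=
  univ.map ⟨fun w : Fin n => Sum.inl (Sum.inl w), fun _ _ h => by simpa using h⟩

/-- `W⁻` on the vertex type `SlyV`. [cite: Sly2010, §2.1] -/
def slyWm (n m D q : ℕ) : Finset (SlyV n m D q) :=
  univ.map ⟨fun w : Fin n => Sum.inr (Sum.inl w), fun _ _ h => by simpa using h⟩

/-- The plus ports (roots) on the vertex type `SlyV`. [cite: Sly2010, §2.1] -/
def slyRp (n m D q : ℕ) : Fin m ↪ SlyV n m D q :=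
  ⟨fun j => Sum.inl (Sum.inr (slyRoot m D q j)), fun _ _ h => slyRoot_injective m D q (by simpa using h)⟩

/-- The minus ports (roots) on the vertex type `SlyV`. [cite: Sly2010, §2.1] -/
def slyRm (n m D q : ℕ) : Fin m ↪ SlyV n m D q :=
  ⟨fun j => Sum.inr (Sum.inr (slyRoot m D q j)), fun _ _ h => slyRoot_injective m D q (by simpa using h)⟩

/-- `|I ∩ W⁺| = |S|` for `I = (S ⊔ K⁺) ⊔ (T ⊔ K⁻)`. [folklore] -/
theorem disjSum_inter_slyWp_card (S T : Finset (Fin n)) (Kp Km : Finset (SlyTreeV m D q)) :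
    ((S.disjSum Kp).disjSum (T.disjSum Km) ∩ slyWp n m D q).card = S.card := by
  classical
  have : (S.disjSum Kp).disjSum (T.disjSum Km) ∩ slyWp n m D q =
      S.map ⟨fun w : Fin n => (Sum.inl (Sum.inl w) : SlyV n m D q), fun _ _ h => by simpa using h⟩ := by
    ext x
    simp only [slyWp, mem_inter, mem_map, mem_univ, true_and, Function.Embedding.coeFn_mk]
    constructor
    · rintro ⟨hx, w, rfl⟩
      exact ⟨w, by simpa using hx, rfl⟩
    · rintro ⟨w, hw, rfl⟩
      exact ⟨by simpa using hw, w, rfl⟩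
  rw [this, card_map]

/-- `|I ∩ W⁻| = |T|` for `I = (S ⊔ K⁺) ⊔ (T ⊔ K⁻)`. [folklore] -/
theorem disjSum_inter_slyWm_card (S T : Finset (Fin n)) (Kp Km : Finset (SlyTreeV m D q)) :
    ((S.disjSum Kp).disjSum (T.disjSum Km) ∩ slyWm n m D q).card = T.card := by
  classical
  have : (S.disjSum Kp).disjSum (T.disjSum Km) ∩ slyWm n m D q =
      T.map ⟨fun w : Fin n => (Sum.inr (Sum.inl w) : SlyV n m D q), fun _ _ h => by simpa using h⟩ := by
    ext x
    simp only [slyWm, mem_inter, mem_map, mem_univ, true_and, Function.Embedding.coeFn_mk]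
    constructor
    · rintro ⟨hx, w, rfl⟩
      exact ⟨w, by simpa using hx, rfl⟩
    · rintro ⟨w, hw, rfl⟩
      exact ⟨by simpa using hw, w, rfl⟩
  rw [this, card_map]

/-- The phase of `I = (S ⊔ K⁺) ⊔ (T ⊔ K⁻)` is `+` iff `|T| ≤ |S|`. [cite: Sly2010, §2.1 (definition of `Y`)] -/
theorem slyPhase_disjSum (S T : Finset (Fin n)) (Kp Km : Finset (SlyTreeV m D q)) :
    slyPhase (slyWp n m D q) (slyWm n m D q) ((S.disjSum Kp).disjSum (T.disjSum Km)) =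
      decide (T.card ≤ S.card) := by
  unfold slyPhase
  rw [disjSum_inter_slyWp_card, disjSum_inter_slyWm_card]

/-- The port configuration of `I = (S ⊔ K⁺) ⊔ (T ⊔ K⁻)` is read off the roots in `K^{±}`. [cite: Sly2010, §2.1 (`σ_V`)] -/
theorem portPattern_disjSum (S T : Finset (Fin n)) (Kp Km : Finset (SlyTreeV m D q)) :
    portPattern (slyRp n m D q) (slyRm n m D q) ((S.disjSum Kp).disjSum (T.disjSum Km)) =
      (univ.filter fun j => slyRoot m D q j ∈ Kp, univ.filter fun j => slyRoot m D q j ∈ Km) := by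
  unfold portPattern
  simp [slyRp, slyRm]

/-- `|I| = |S| + |K⁺| + |T| + |K⁻|`. [folklore] -/
theorem card_disjSum_disjSum (S T : Finset (Fin n)) (Kp Km : Finset (SlyTreeV m D q)) :
    ((S.disjSum Kp).disjSum (T.disjSum Km)).card = S.card + Kp.card + T.card + Km.card := by
  rw [card_disjSum, card_disjSum, card_disjSum]; ring

/-- Moving an outer sum inside past three sums. [folklore] -/
theorem sum_comm_in3 {α β γ ε M : Type*} [Fintype α] [Fintype β] [Fintype γ] [Fintype ε]
    [AddCommMonoid M] (f : ε → α → β → γ → M) :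
    ∑ e, ∑ a, ∑ b, ∑ c, f e a b c = ∑ a, ∑ b, ∑ c, ∑ e, f e a b c := by
  rw [Finset.sum_comm]
  refine sum_congr rfl fun a _ => ?_
  rw [Finset.sum_comm]
  refine sum_congr rfl fun b _ => ?_
  rw [Finset.sum_comm]

/-- Moving an outer sum inside past five sums. [folklore] -/
theorem sum_comm_in5 {α β γ δ ε ζ M : Type*} [Fintype α] [Fintype β] [Fintype γ] [Fintype δ] [Fintype ε]
    [Fintype ζ] [AddCommMonoid M] (f : ε → α → β → γ → δ → ζ → M) :
    ∑ e, ∑ a, ∑ b, ∑ c, ∑ d, ∑ x, f e a b c d x = ∑ a, ∑ b, ∑ c, ∑ d, ∑ x, ∑ e, f e a b c d x := by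
  rw [Finset.sum_comm]
  refine sum_congr rfl fun a _ => ?_
  rw [Finset.sum_comm]
  refine sum_congr rfl fun b _ => ?_
  rw [Finset.sum_comm]
  refine sum_congr rfl fun c _ => ?_
  rw [Finset.sum_comm]
  refine sum_congr rfl fun d _ => ?_
  rw [Finset.sum_comm]

/-- Summing over the subsets of the gadget = summing over `(S, K⁺, T, K⁻)`. [folklore] -/
theorem sum_finset_slyV (f : Finset (SlyV n m D q) → ℝ) :
    ∑ I, f I = ∑ S : Finset (Fin n), ∑ Kp : Finset (SlyTreeV m D q), ∑ T : Finset (Fin n),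
      ∑ Km : Finset (SlyTreeV m D q), f ((S.disjSum Kp).disjSum (T.disjSum Km)) := by
  rw [← (Finset.sumEquiv (α := SlySideV n m D q) (β := SlySideV n m D q)).symm.toEquiv.sum_comp,
    Fintype.sum_prod_type,
    ← (Finset.sumEquiv (α := Fin n) (β := SlyTreeV m D q)).symm.toEquiv.sum_comp, Fintype.sum_prod_type]
  refine sum_congr rfl fun S _ => sum_congr rfl fun Kp _ => ?_
  rw [← (Finset.sumEquiv (α := Fin n) (β := SlyTreeV m D q)).symm.toEquiv.sum_comp, Fintype.sum_prod_type]
  rfl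

open scoped Classical in
/-- **The partition function of the gadget over the cut at `U`** (Sly §4.1: "appending trees onto `G̃`
to construct `G` has the effect of reweighting the projection of the measure on `{0,1}^U`" by `κ(η)`;
in expectation "`E Z^{±}_G = Σ_η E Z^{±}_{G̃}(η) κ(η)`"), refined by the port configuration: for every
realisation `(σ, τ)` of the matchings, phase `s` and port configuration `(S⁺, S⁻)`,
`Z_G(λ; Y = s ∧ σ_V = (S⁺, S⁻)) = Σ_{η = (E⁺, E⁻)} Z^{s}_{G̃(σ,τ)}(η) · κ_{S⁺}(E⁺) κ_{S⁻}(E⁻)`.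
[cite: Sly2010, §4.1 (the displays for `P_G(σ_U = η ∣ Y = +)` and `E Z^{±}_G = Σ_η E Z^{±}_{G̃}(η) κ(η)`)] -/
theorem hardcoreZOn_slyGadget_phase_pattern (lam : ℝ) (s : Bool) (Sp Sm : Finset (Fin m)) :
    hardcoreZOn (slyGadgetGraph n m D q σ τ) lam
        (fun I => slyPhase (slyWp n m D q) (slyWm n m D q) I = s ∧
          portPattern (slyRp n m D q) (slyRm n m D q) I = (Sp, Sm)) =
      ∑ Ep : Finset (Fin (m * q ^ D)), ∑ Em : Finset (Fin (m * q ^ D)),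
        slyCoreZ σ τ lam s Ep Em * (slyForestZ m D q lam Ep Sp * slyForestZ m D q lam Em Sm) := by
  -- the three factors of a summand
  set c : Finset (Fin (m * q ^ D)) → Finset (Fin (m * q ^ D)) → Finset (Fin n) → Finset (Fin n) → ℝ :=
    fun Ep Em S T => if decide (T.card ≤ S.card) = s ∧ SlyCoreIndep σ τ S T Ep Em then
      lam ^ (S.card + T.card + Ep.card + Em.card) else 0 with hc
  set a₀ : Finset (Fin m) → Finset (SlyTreeV m D q) → ℝ := fun R K =>
    if SlyForestIndep q K ∧ (∀ j, slyRoot m D q j ∈ K ↔ j ∈ R) then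
      lam ^ (K.filter fun t => (t.1.1 : ℕ) < D).card else 0 with ha₀
  have hFZ : ∀ (E : Finset (Fin (m * q ^ D))) (R : Finset (Fin m)),
      slyForestZ m D q lam E R = ∑ K : Finset (SlyTreeV m D q), if E = slyLeafPart K then a₀ R K else 0 := by
    intro E R
    unfold slyForestZ
    refine sum_congr rfl fun K _ => ?_
    by_cases hE : E = slyLeafPart K
    · have hE' : ∀ u, slyLeaf m D q u ∈ K ↔ u ∈ E := (slyLeafPart_eq_iff K E).2 hE
      simp only [hE', implies_true, true_and, hE, if_true, ha₀]
    · have hE' : ¬∀ u, slyLeaf m D q u ∈ K ↔ u ∈ E := mt (slyLeafPart_eq_iff K E).1 hE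
      simp only [hE', false_and, if_false, hE]
  have hCZ : ∀ Ep Em, slyCoreZ σ τ lam s Ep Em = ∑ S, ∑ T, c Ep Em S T := fun _ _ => rfl
  -- the right-hand side as a fourfold sum over `(S, K⁺, T, K⁻)`
  have hA : (∑ Ep : Finset (Fin (m * q ^ D)), ∑ Em : Finset (Fin (m * q ^ D)),
        slyCoreZ σ τ lam s Ep Em * (slyForestZ m D q lam Ep Sp * slyForestZ m D q lam Em Sm)) =
      ∑ S : Finset (Fin n), ∑ Kp : Finset (SlyTreeV m D q), ∑ T : Finset (Fin n),
        ∑ Km : Finset (SlyTreeV m D q),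
          c (slyLeafPart Kp) (slyLeafPart Km) S T * (a₀ Sp Kp * a₀ Sm Km) := by
    have h1 : ∀ Ep Em, slyCoreZ σ τ lam s Ep Em * (slyForestZ m D q lam Ep Sp * slyForestZ m D q lam Em Sm) =
        ∑ S : Finset (Fin n), ∑ Kp : Finset (SlyTreeV m D q), ∑ T : Finset (Fin n),
          ∑ Km : Finset (SlyTreeV m D q),
            c Ep Em S T * ((if Ep = slyLeafPart Kp then a₀ Sp Kp else 0) *
              (if Em = slyLeafPart Km then a₀ Sm Km else 0)) := by
      intro Ep Em
      rw [hCZ, hFZ, hFZ, Finset.sum_mul_sum, Finset.sum_mul_sum]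
      refine sum_congr rfl fun S _ => sum_congr rfl fun Kp _ => ?_
      rw [Finset.sum_mul]
      refine sum_congr rfl fun T _ => ?_
      rw [Finset.mul_sum]
    simp_rw [h1]
    rw [sum_comm_in5, sum_comm_in5]
    refine sum_congr rfl fun S _ => sum_congr rfl fun Kp _ => sum_congr rfl fun T _ =>
      sum_congr rfl fun Km _ => ?_
    rw [Finset.sum_eq_single (slyLeafPart Kp)]
    · rw [Finset.sum_eq_single (slyLeafPart Km)]
      · simp
      · intro Em _ hne; simp [hne]
      · simp
    · intro Ep _ hne; simp [hne]
    · simp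
  rw [hA, hardcoreZOn_def, sum_finset_slyV]
  refine sum_congr rfl fun S _ => sum_congr rfl fun Kp _ => sum_congr rfl fun T _ =>
    sum_congr rfl fun Km _ => ?_
  -- pointwise identification of the summands
  have hrp : (univ.filter fun j => slyRoot m D q j ∈ Kp) = Sp ↔ ∀ j, slyRoot m D q j ∈ Kp ↔ j ∈ Sp := by
    constructor
    · rintro rfl j; simp
    · intro h; ext j; simp [h j]
  have hrm : (univ.filter fun j => slyRoot m D q j ∈ Km) = Sm ↔ ∀ j, slyRoot m D q j ∈ Km ↔ j ∈ Sm := by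
    constructor
    · rintro rfl j; simp
    · intro h; ext j; simp [h j]
  simp only [isIndepSet_disjSum_iff, slyPhase_disjSum, portPattern_disjSum, card_disjSum_disjSum,
    Prod.mk.injEq, hrp, hrm, hc, ha₀]
  by_cases hall : (SlyCoreIndep σ τ S T (slyLeafPart Kp) (slyLeafPart Km) ∧ SlyForestIndep q Kp ∧
      SlyForestIndep q Km) ∧ (decide (T.card ≤ S.card) = s ∧ (∀ j, slyRoot m D q j ∈ Kp ↔ j ∈ Sp) ∧
        (∀ j, slyRoot m D q j ∈ Km ↔ j ∈ Sm))
  · obtain ⟨⟨hCI, hFp, hFm⟩, hph, hRp, hRm⟩ := hall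
    rw [if_pos ⟨⟨hCI, hFp, hFm⟩, hph, hRp, hRm⟩, if_pos ⟨hph, hCI⟩, if_pos ⟨hFp, hRp⟩, if_pos ⟨hFm, hRm⟩,
      ← pow_add, ← pow_add]
    congr 1
    rw [card_eq_internal_add_leafPart Kp, card_eq_internal_add_leafPart Km]; ring
  · rw [if_neg hall]
    by_cases h1 : decide (T.card ≤ S.card) = s ∧ SlyCoreIndep σ τ S T (slyLeafPart Kp) (slyLeafPart Km)
    · by_cases h2 : SlyForestIndep q Kp ∧ ∀ j, slyRoot m D q j ∈ Kp ↔ j ∈ Sp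
      · by_cases h3 : SlyForestIndep q Km ∧ ∀ j, slyRoot m D q j ∈ Km ↔ j ∈ Sm
        · exact absurd ⟨⟨h1.2, h2.1, h3.1⟩, h1.1, h2.2, h3.2⟩ hall
        · rw [if_neg h3]; ring
      · rw [if_neg h2]; ring
    · rw [if_neg h1]; ring

end CutDecomposition

/-! #### Transport to `Fin v` -/

section Transport

open scoped Classical in
/-- **Restricted partition functions are invariant under graph isomorphisms** (relabelling the
vertices by an equivalence `e`, events pulled back along `I ↦ e(I)`). [folklore] -/
theorem hardcoreZOn_map_equiv {V W : Type*} [Fintype V] [DecidableEq V] [Fintype W] [DecidableEq W]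
    (G : SimpleGraph V) (e : V ≃ W) (lam : ℝ) (E : Finset W → Prop) :
    hardcoreZOn (G.map e) lam E = hardcoreZOn G lam (fun I => E (I.map e.toEmbedding)) := by
  rw [hardcoreZOn_def, hardcoreZOn_def, ← (Equiv.finsetCongr e).sum_comp]
  refine sum_congr rfl fun I _ => ?_
  have hind : (G.map e).IsIndepSet ↑(I.map e.toEmbedding) ↔ G.IsIndepSet ↑I := by
    constructor
    · intro h a ha b hb hab hadj
      refine h (Finset.mem_coe.2 (Finset.mem_map_of_mem _ ha)) (Finset.mem_coe.2 (Finset.mem_map_of_mem _ hb))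
        (fun h' => hab (e.injective h')) ?_
      exact (SimpleGraph.map_adj_apply (G := G) (f := (e : V ↪ W))).2 hadj
    · intro h x hx y hy hxy hadj
      obtain ⟨a, ha, rfl⟩ := Finset.mem_map.1 (Finset.mem_coe.1 hx)
      obtain ⟨b, hb, rfl⟩ := Finset.mem_map.1 (Finset.mem_coe.1 hy)
      exact h (Finset.mem_coe.2 ha) (Finset.mem_coe.2 hb) (fun h' => hxy (by rw [h']))
        ((SimpleGraph.map_adj_apply (G := G) (f := (e : V ↪ W))).1 hadj)
  simp only [Equiv.finsetCongr_apply, card_map, hind]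

open scoped Classical in
/-- Restricted partition functions add up over the fibres of any observable. [folklore] -/
theorem hardcoreZOn_eq_sum_fiber {V Y : Type*} [Fintype V] [DecidableEq V] [Fintype Y]
    (G : SimpleGraph V) (lam : ℝ) (E : Finset V → Prop) (g : Finset V → Y) :
    hardcoreZOn G lam E = ∑ y, hardcoreZOn G lam (fun I => E I ∧ g I = y) := by
  simp only [hardcoreZOn_def]
  rw [Finset.sum_comm]
  refine sum_congr rfl fun I _ => ?_
  rw [Finset.sum_eq_single (g I)]
  · by_cases h : G.IsIndepSet ↑I ∧ E I <;> simp [h]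
  · intro y _ hy; rw [if_neg]; exact fun h => hy h.2.2.symm
  · simp

/-- The phase is invariant under relabelling. [folklore] -/
theorem slyPhase_map {V W : Type*} [DecidableEq V] [DecidableEq W] (f : V ↪ W) (Wp Wm I : Finset V) :
    slyPhase (Wp.map f) (Wm.map f) (I.map f) = slyPhase Wp Wm I := by
  unfold slyPhase
  rw [← Finset.map_inter, ← Finset.map_inter, card_map, card_map]

/-- The port configuration is invariant under relabelling. [folklore] -/
theorem portPattern_map {V W : Type*} [DecidableEq V] [DecidableEq W] {m : ℕ} (f : V ↪ W)
    (Vp Vm : Fin m ↪ V) (I : Finset V) :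
    portPattern (Vp.trans f) (Vm.trans f) (I.map f) = portPattern Vp Vm I := by
  unfold portPattern
  simp [Finset.mem_map']

variable (σ : Fin q → Equiv.Perm (Fin (n + m * q ^ D))) (τ : Equiv.Perm (Fin n))

/-- `W⁺` over `Fin v` is the image of `W⁺` on `SlyV`. [folklore] -/
theorem slyWPlus_eq_map : slyWPlus n m D q = (slyWp n m D q).map (slyNum n m D q).toEmbedding := by
  unfold slyWPlus slyWp; rw [Finset.map_map]; rfl

/-- `W⁻` over `Fin v` is the image of `W⁻` on `SlyV`. [folklore] -/
theorem slyWMinus_eq_map : slyWMinus n m D q = (slyWm n m D q).map (slyNum n m D q).toEmbedding := by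
  unfold slyWMinus slyWm; rw [Finset.map_map]; rfl

/-- The plus ports over `Fin v` are the numbered roots. [folklore] -/
theorem slyPortPlus_eq_trans : slyPortPlus n m D q = (slyRp n m D q).trans (slyNum n m D q).toEmbedding := by
  ext j; rfl

/-- The minus ports over `Fin v` are the numbered roots. [folklore] -/
theorem slyPortMinus_eq_trans : slyPortMinus n m D q = (slyRm n m D q).trans (slyNum n m D q).toEmbedding := by
  ext j; rfl

open scoped Classical in
/-- **The cut decomposition for the gadget over `Fin v`**:
`Z_G(λ; Y = s ∧ σ_V = (S⁺, S⁻)) = Σ_{(E⁺, E⁻)} Z^{s}_{G̃(σ,τ)}(E⁺, E⁻) κ_{S⁺}(E⁺) κ_{S⁻}(E⁻)`.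
[cite: Sly2010, §4.1] -/
theorem hardcoreZOn_slyGadgetFin_phase_pattern (lam : ℝ) (s : Bool) (Sp Sm : Finset (Fin m)) :
    hardcoreZOn (slyGadgetFin n m D q σ τ) lam
        (fun I => slyPhase (slyWPlus n m D q) (slyWMinus n m D q) I = s ∧
          portPattern (slyPortPlus n m D q) (slyPortMinus n m D q) I = (Sp, Sm)) =
      ∑ Ep : Finset (Fin (m * q ^ D)), ∑ Em : Finset (Fin (m * q ^ D)),
        slyCoreZ σ τ lam s Ep Em * (slyForestZ m D q lam Ep Sp * slyForestZ m D q lam Em Sm) := by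
  rw [← hardcoreZOn_slyGadget_phase_pattern, slyGadgetFin, hardcoreZOn_map_equiv]
  congr 1
  funext I
  rw [slyWPlus_eq_map, slyWMinus_eq_map, slyPortPlus_eq_trans, slyPortMinus_eq_trans, slyPhase_map,
    portPattern_map]

open scoped Classical in
/-- **`Z_G(λ; Y = s) = Σ_{(E⁺,E⁻)} Z^{s}_{G̃(σ,τ)}(E⁺,E⁻) κ(E⁺) κ(E⁻)`** with the unrestricted forest
weights `κ(E) = Σ_S κ_S(E)` (Sly's "`E Z^{±}_G = Σ_η E Z^{±}_{G̃}(η) κ(η)`", before expectations).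
[cite: Sly2010, §4.1, proof of Theorem 2.1] -/
theorem hardcoreZOn_slyGadgetFin_phase (lam : ℝ) (s : Bool) :
    hardcoreZOn (slyGadgetFin n m D q σ τ) lam (fun I => slyPhase (slyWPlus n m D q) (slyWMinus n m D q) I = s) =
      ∑ Ep : Finset (Fin (m * q ^ D)), ∑ Em : Finset (Fin (m * q ^ D)),
        slyCoreZ σ τ lam s Ep Em *
          ((∑ Sp : Finset (Fin m), slyForestZ m D q lam Ep Sp) * (∑ Sm : Finset (Fin m), slyForestZ m D q lam Em Sm)) := by
  rw [hardcoreZOn_eq_sum_fiber _ _ _ (portPattern (slyPortPlus n m D q) (slyPortMinus n m D q)),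
    Fintype.sum_prod_type]
  simp_rw [hardcoreZOn_slyGadgetFin_phase_pattern]
  -- `Σ_{Sp} Σ_{Sm} Σ_{Ep} Σ_{Em} c (a b) = Σ_{Ep} Σ_{Em} c (Σ a)(Σ b)`
  simp_rw [Finset.sum_mul_sum, Finset.mul_sum]
  rw [sum_comm_in3, sum_comm_in3]

end Transport

/-! #### Averaging the core weights over the matchings: `E Z^{±}_{G̃}(η) = slyZplus / slyZminus` -/

section CoreAverage

/-- Summing over all subsets of `Fin n` by cardinality. [folklore] -/
theorem sum_finset_fin_eq_sum_powersetCard {M : Type*} [AddCommMonoid M] (n : ℕ) (f : Finset (Fin n) → M) :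
    ∑ S : Finset (Fin n), f S = ∑ a ∈ range (n + 1), ∑ S ∈ (univ : Finset (Fin n)).powersetCard a, f S := by
  rw [← Finset.powerset_univ, Finset.sum_powerset, Finset.card_univ, Fintype.card_fin]

open scoped Classical in
/-- The realised core weight of phase `+`, organised by the sizes `a = |S| ≥ b = |T|`. [folklore] -/
theorem slyCoreZ_true_eq {n m' k : ℕ} (σ : Fin k → Equiv.Perm (Fin (n + m'))) (τ : Equiv.Perm (Fin n))
    (lam : ℝ) (Ep Em : Finset (Fin m')) :
    slyCoreZ σ τ lam true Ep Em =
      ∑ a ∈ range (n + 1), ∑ b ∈ range (a + 1),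
        ∑ S ∈ (univ : Finset (Fin n)).powersetCard a, ∑ T ∈ (univ : Finset (Fin n)).powersetCard b,
          if SlyCoreIndep σ τ S T Ep Em then lam ^ (a + b + Ep.card + Em.card) else 0 := by
  unfold slyCoreZ
  rw [sum_finset_fin_eq_sum_powersetCard]
  refine sum_congr rfl fun a ha => ?_
  have ha' : a ≤ n := Nat.lt_succ_iff.1 (mem_range.1 ha)
  -- organise the inner sum over `T` by `b = |T|`, then swap with the sum over `S`
  have h1 : ∀ S ∈ (univ : Finset (Fin n)).powersetCard a,
      (∑ T : Finset (Fin n), if decide (T.card ≤ S.card) = true ∧ SlyCoreIndep σ τ S T Ep Em then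
          lam ^ (S.card + T.card + Ep.card + Em.card) else 0) =
        ∑ b ∈ range (a + 1), ∑ T ∈ (univ : Finset (Fin n)).powersetCard b,
          if SlyCoreIndep σ τ S T Ep Em then lam ^ (a + b + Ep.card + Em.card) else 0 := by
    intro S hS
    have hSa : S.card = a := (mem_powersetCard.1 hS).2
    rw [sum_finset_fin_eq_sum_powersetCard]
    -- the terms with `b > a` vanish, those with `b ≤ a` lose the phase indicator
    have h2 : ∀ b ∈ range (n + 1), (∑ T ∈ (univ : Finset (Fin n)).powersetCard b,
        if decide (T.card ≤ S.card) = true ∧ SlyCoreIndep σ τ S T Ep Em then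
          lam ^ (S.card + T.card + Ep.card + Em.card) else 0) =
        if b ≤ a then ∑ T ∈ (univ : Finset (Fin n)).powersetCard b,
          if SlyCoreIndep σ τ S T Ep Em then lam ^ (a + b + Ep.card + Em.card) else 0 else 0 := by
      intro b _
      by_cases hb : b ≤ a
      · rw [if_pos hb]
        refine sum_congr rfl fun T hT => ?_
        have hTb : T.card = b := (mem_powersetCard.1 hT).2
        simp [hSa, hTb, hb]
      · rw [if_neg hb]
        refine sum_eq_zero fun T hT => ?_
        have hTb : T.card = b := (mem_powersetCard.1 hT).2
        simp [hSa, hTb, hb]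
    rw [sum_congr rfl h2, ← Finset.sum_filter]
    congr 1
    ext b
    simp only [mem_filter, mem_range]
    omega
  rw [sum_congr rfl h1, Finset.sum_comm]

open scoped Classical in
/-- The realised core weight of phase `-`, organised by the sizes `a = |S| < b = |T|`. [folklore] -/
theorem slyCoreZ_false_eq {n m' k : ℕ} (σ : Fin k → Equiv.Perm (Fin (n + m'))) (τ : Equiv.Perm (Fin n))
    (lam : ℝ) (Ep Em : Finset (Fin m')) :
    slyCoreZ σ τ lam false Ep Em =
      ∑ a ∈ range (n + 1), ∑ b ∈ Ioc a n,
        ∑ S ∈ (univ : Finset (Fin n)).powersetCard a, ∑ T ∈ (univ : Finset (Fin n)).powersetCard b,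
          if SlyCoreIndep σ τ S T Ep Em then lam ^ (a + b + Ep.card + Em.card) else 0 := by
  unfold slyCoreZ
  rw [sum_finset_fin_eq_sum_powersetCard]
  refine sum_congr rfl fun a ha => ?_
  have h1 : ∀ S ∈ (univ : Finset (Fin n)).powersetCard a,
      (∑ T : Finset (Fin n), if decide (T.card ≤ S.card) = false ∧ SlyCoreIndep σ τ S T Ep Em then
          lam ^ (S.card + T.card + Ep.card + Em.card) else 0) =
        ∑ b ∈ Ioc a n, ∑ T ∈ (univ : Finset (Fin n)).powersetCard b,
          if SlyCoreIndep σ τ S T Ep Em then lam ^ (a + b + Ep.card + Em.card) else 0 := by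
    intro S hS
    have hSa : S.card = a := (mem_powersetCard.1 hS).2
    rw [sum_finset_fin_eq_sum_powersetCard]
    have h2 : ∀ b ∈ range (n + 1), (∑ T ∈ (univ : Finset (Fin n)).powersetCard b,
        if decide (T.card ≤ S.card) = false ∧ SlyCoreIndep σ τ S T Ep Em then
          lam ^ (S.card + T.card + Ep.card + Em.card) else 0) =
        if a < b then ∑ T ∈ (univ : Finset (Fin n)).powersetCard b,
          if SlyCoreIndep σ τ S T Ep Em then lam ^ (a + b + Ep.card + Em.card) else 0 else 0 := by
      intro b _
      by_cases hb : a < b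
      · rw [if_pos hb]
        refine sum_congr rfl fun T hT => ?_
        have hTb : T.card = b := (mem_powersetCard.1 hT).2
        have hb' : ¬b ≤ a := by omega
        simp [hSa, hTb, hb']
      · rw [if_neg hb]
        refine sum_eq_zero fun T hT => ?_
        have hTb : T.card = b := (mem_powersetCard.1 hT).2
        have hb' : b ≤ a := by omega
        simp [hSa, hTb, hb']
    rw [sum_congr rfl h2, ← Finset.sum_filter]
    congr 1
    ext b
    simp only [mem_filter, mem_range, mem_Ioc]
    omega
  rw [sum_congr rfl h1, Finset.sum_comm]

/-- **`E Z⁺_{G̃}(η) = slyZplus`**: the average of the realised plus-phase core weight over the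
matchings `(σ, τ) ∈ (Perm [n+m'])^k × Perm [n]` is Sly's explicit sum `Σ_{a ≥ b} E Z^{a,b}_{G̃}(η)`
(`sly_firstMoment`, eq. (e:gtEZ1)). [cite: Sly2010, §3 (proof of Lemma 3.1, eq. (e:gtEZ1); definition of `Z⁺_{G̃}(η)`)] -/
theorem slyCoreZ_average_true {n m' k : ℕ} (lam : ℝ) (Ep Em : Finset (Fin m')) :
    (∑ σ : Fin k → Equiv.Perm (Fin (n + m')), ∑ τ : Equiv.Perm (Fin n), slyCoreZ σ τ lam true Ep Em) /
        (((n + m').factorial : ℝ) ^ k * (n.factorial : ℝ)) =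
      slyZplus n m' k lam Ep.card Em.card := by
  classical
  simp_rw [slyCoreZ_true_eq]
  rw [slyZplus_def]
  -- pull the sums over `a, b` out of the average
  set X : (Fin k → Equiv.Perm (Fin (n + m'))) → Equiv.Perm (Fin n) → ℕ → ℕ → ℝ := fun σ τ a b =>
    ∑ S ∈ (univ : Finset (Fin n)).powersetCard a, ∑ T ∈ (univ : Finset (Fin n)).powersetCard b,
      if SlyCoreIndep σ τ S T Ep Em then lam ^ (a + b + Ep.card + Em.card) else 0 with hX
  have hL : (∑ σ : Fin k → Equiv.Perm (Fin (n + m')), ∑ τ : Equiv.Perm (Fin n),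
      ∑ a ∈ range (n + 1), ∑ b ∈ range (a + 1), X σ τ a b) =
      ∑ a ∈ range (n + 1), ∑ b ∈ range (a + 1), ∑ σ : Fin k → Equiv.Perm (Fin (n + m')),
        ∑ τ : Equiv.Perm (Fin n), X σ τ a b := by
    calc (∑ σ : Fin k → Equiv.Perm (Fin (n + m')), ∑ τ : Equiv.Perm (Fin n),
          ∑ a ∈ range (n + 1), ∑ b ∈ range (a + 1), X σ τ a b)
        = ∑ σ : Fin k → Equiv.Perm (Fin (n + m')), ∑ a ∈ range (n + 1), ∑ τ : Equiv.Perm (Fin n),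
            ∑ b ∈ range (a + 1), X σ τ a b := sum_congr rfl fun σ _ => Finset.sum_comm
      _ = ∑ a ∈ range (n + 1), ∑ σ : Fin k → Equiv.Perm (Fin (n + m')), ∑ τ : Equiv.Perm (Fin n),
            ∑ b ∈ range (a + 1), X σ τ a b := Finset.sum_comm
      _ = ∑ a ∈ range (n + 1), ∑ σ : Fin k → Equiv.Perm (Fin (n + m')), ∑ b ∈ range (a + 1),
            ∑ τ : Equiv.Perm (Fin n), X σ τ a b :=
          sum_congr rfl fun a _ => sum_congr rfl fun σ _ => Finset.sum_comm
      _ = _ := sum_congr rfl fun a _ => Finset.sum_comm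
  rw [hL, Finset.sum_div]
  refine sum_congr rfl fun a _ => ?_
  rw [Finset.sum_div]
  refine sum_congr rfl fun b _ => ?_
  rw [slyF_def, ← sly_firstMoment n m' k a b Ep Em lam, hX]
  congr 1
  refine sum_congr rfl fun σ _ => sum_congr rfl fun τ _ => sum_congr rfl fun S _ => sum_congr rfl fun T _ => ?_
  exact if_congr Iff.rfl rfl rfl

/-- **`E Z⁻_{G̃}(η) = slyZminus`**. [cite: Sly2010, §3 (eq. (e:gtEZ1); definition of `Z⁻_{G̃}(η)`)] -/
theorem slyCoreZ_average_false {n m' k : ℕ} (lam : ℝ) (Ep Em : Finset (Fin m')) :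
    (∑ σ : Fin k → Equiv.Perm (Fin (n + m')), ∑ τ : Equiv.Perm (Fin n), slyCoreZ σ τ lam false Ep Em) /
        (((n + m').factorial : ℝ) ^ k * (n.factorial : ℝ)) =
      slyZminus n m' k lam Ep.card Em.card := by
  classical
  simp_rw [slyCoreZ_false_eq]
  rw [slyZminus_def]
  set X : (Fin k → Equiv.Perm (Fin (n + m'))) → Equiv.Perm (Fin n) → ℕ → ℕ → ℝ := fun σ τ a b =>
    ∑ S ∈ (univ : Finset (Fin n)).powersetCard a, ∑ T ∈ (univ : Finset (Fin n)).powersetCard b,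
      if SlyCoreIndep σ τ S T Ep Em then lam ^ (a + b + Ep.card + Em.card) else 0 with hX
  have hL : (∑ σ : Fin k → Equiv.Perm (Fin (n + m')), ∑ τ : Equiv.Perm (Fin n),
      ∑ a ∈ range (n + 1), ∑ b ∈ Ioc a n, X σ τ a b) =
      ∑ a ∈ range (n + 1), ∑ b ∈ Ioc a n, ∑ σ : Fin k → Equiv.Perm (Fin (n + m')),
        ∑ τ : Equiv.Perm (Fin n), X σ τ a b := by
    calc (∑ σ : Fin k → Equiv.Perm (Fin (n + m')), ∑ τ : Equiv.Perm (Fin n),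
          ∑ a ∈ range (n + 1), ∑ b ∈ Ioc a n, X σ τ a b)
        = ∑ σ : Fin k → Equiv.Perm (Fin (n + m')), ∑ a ∈ range (n + 1), ∑ τ : Equiv.Perm (Fin n),
            ∑ b ∈ Ioc a n, X σ τ a b := sum_congr rfl fun σ _ => Finset.sum_comm
      _ = ∑ a ∈ range (n + 1), ∑ σ : Fin k → Equiv.Perm (Fin (n + m')), ∑ τ : Equiv.Perm (Fin n),
            ∑ b ∈ Ioc a n, X σ τ a b := Finset.sum_comm
      _ = ∑ a ∈ range (n + 1), ∑ σ : Fin k → Equiv.Perm (Fin (n + m')), ∑ b ∈ Ioc a n,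
            ∑ τ : Equiv.Perm (Fin n), X σ τ a b :=
          sum_congr rfl fun a _ => sum_congr rfl fun σ _ => Finset.sum_comm
      _ = _ := sum_congr rfl fun a _ => Finset.sum_comm
  rw [hL, Finset.sum_div]
  refine sum_congr rfl fun a _ => ?_
  rw [Finset.sum_div]
  refine sum_congr rfl fun b _ => ?_
  rw [slyF_def, ← sly_firstMoment n m' k a b Ep Em lam, hX]
  congr 1
  refine sum_congr rfl fun σ _ => sum_congr rfl fun τ _ => sum_congr rfl fun S _ => sum_congr rfl fun T _ => ?_
  exact if_congr Iff.rfl rfl rfl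

end CoreAverage

end GadgetConstruction

end Literature.Computability.Complexity
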